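import Summits.BirchSwinnertonDyer.BirchSwinnertonDyer.Theorems.ClassRecordThreeCartanSupplyHeckeFamily
import Summits.BirchSwinnertonDyer.BirchSwinnertonDyer.Theorems.ClassRecordThreeCartanSupplyOneSidedTypeCut
import Summits.BirchSwinnertonDyer.BirchSwinnertonDyer.Theorems.ClassRecordThreeCartanSupplyCubicCharacterTables
import Summits.BirchSwinnertonDyer.BirchSwinnertonDyer.Theorems.ClassRecordThreeCartanNaturalRouteClosers
import Summits.BirchSwinnertonDyer.BirchSwinnertonDyer.Theorems.ClassRecordThreeEulerHalvesAtThreeCartanCarayolCuspLift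
import Summits.BirchSwinnertonDyer.BirchSwinnertonDyer.Theorems.ClassRecordThreeEulerHalvesAtThreeCartanCoverPrintClausesDescent
import HarnessLib

/-!
# Line `ghost` — crux 24801 `CartanOnePlaceDegreeLawAtThree` (NUM), generation 27 (lineage `cruxidea-stmt-BirchSwinnertonDyer-24801-1`; UNREGISTERED, W-79):
THE RATIONAL-GHOST CUT at `q ≡ 1 (3)` — the Jacquet-vector leaf (JV) of generations 25–26 is NOT a local–global leaf on the residue class `q ≡ 1 (12)`.

FRAME OF RECORD (registry rev 9 = `Lines/jacquet.lean` 46f023ee71649e4c; generation 26 `Lines/eigentransfer.lean` bae8bee8fc1d457d):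
NUM ⟸ (MO1) ∧ (JV) ∧ (NCB) ∧ (CV♭) ∧ ((DS) ∧ (JLᶜ)), with (BCV) ⟸ (JV) ∧ (NCB) ∧ (LL) (§L.5) and (VAN) ⟸ (LL) ∧ (CV♭) ∧ (MO1) (§J.5).
(JV) «`ℂ[G]·dockNonsplit F₀` has a non-zero `N`-fixed vector» says, in print, «`π_{V,q}` is NOT supercuspidal» — the one place where generations 25–26 still
spend local–global compatibility at a PRINCIPAL-SERIES place `q ≡ 1 (3)` («IDEA-NEEDED in tree»).

THE NEW LEVER (§N, sorry-free glue): INTEGRALITY KILLS THE CUSPIDAL GHOST. If `W_C = ℂ[G]·u_C` had no `N`-fixed vector it would be an irreducible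
((IRR)♮ ⟸ (L1S) ⟸ (MO1), tree) CUSPIDAL representation `π(ν)` of `GL₂(𝔽_q)` with a `T_η`-fixed vector (`u_C`; so trivial central character, `ν` a regular
character of the cyclic group `𝔽_{q²}^× ∕ 𝔽_q^×` of order `q + 1`) and an INTEGER-valued character ((RAT)♮, generation 15: the period lattice is a `G`-stable
`ℤ`-form). Its character on an elliptic element with eigenvalue `x` is `−(ν(x) + ν(x)⁻¹)`, so rationality forces `φ(ord ν) ≤ 2`, i.e. `ord ν ∈ {3, 4, 6}`, and
`ord ν ∣ q + 1`. At `q ≡ 1 (3)` we have `3 ∤ q + 1`, hence `ord ν = 4` and `4 ∣ q + 1`: A RATIONAL CUSPIDAL GHOST EXISTS ONLY AT `q ≡ 3 (mod 4)`. This is ONE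
finite-group lemma, (RCG) `RationalCuspidalGhost`, stated abstractly like the tree's (FGT-C) — and (RCG) itself is PROVED (§N.4) from the residue-class-free
cuspidal row of the character table, (CTT) `CuspidalTorusType` («an irreducible `W` with a `T_η`-fixed vector and no `N`-fixed vector has trace `−(ζ + ζ⁻¹)` at some
`t ∈ T_η`, `ζ` a primitive `n`-th root of unity, `3 ≤ n ∣ q + 1`»), by Niven's list in algebraic form (`ζ + ζ⁻¹ ∈ ℤ` ⟹ `n ∣ 4 ∨ n ∣ 6`, PROVED) and
`q ≡ 1 (3)` ⟹ `n = 4` (PROVED). Consequently (§N.3 ∕ §N.4, PROVED):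
  (JV_Q) ⟸ (IRR)♮ ∧ (RAT)♮ ∧ (RCG) ∧ (JV₇),   (RCG) ⟸ (CTT),
where (JV_Q) `JacquetVectorDocked` is (JV) at `F₀ = Q.form` (all that §L.5 ever consumes — PROVED WEAKER than (JV): `jacquetVectorDocked_of_free`) and (JV₇)
`JacquetVectorResidual` is (JV_Q) restricted to `q ≡ 3 (mod 4)` (i.e. to `q ≡ 7 (12)`): the ONLY residue class on which a Jacquet vector still has to be found by a
local–global argument (in print: exclusion of the single rational ghost `π(ν₄)`, the `e = 4` type of Kodaira III ∕ III*, against `3 ∣ c_q` ⟹ `e = 3`).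
On `q ≡ 1 (12)` (half of the principal-series places) the existence half of the type is now FINITE GROUP THEORY + PERIOD-LATTICE INTEGRALITY + (MO1).

This is generation 15's move («integrality + cuspidality leave `ord ν ∈ {3,4,6}`», made at the CUSPIDAL place `q ≡ 2 (3)` to shrink Carayol to `q ≡ 11 (12)`)
made at the PRINCIPAL-SERIES place, where nobody had made it: there the ghost list `{3,4,6} ∩ {n : n ∣ q+1}` is EMPTY or `{4}`, so the existence leaf (JV) —
not a vanishing clause — is what falls. (NCB) is untouched but RE-SOURCED (line card): a non-cubic Borel eigenvector certifies BY ITSELF that `π_{V,q}` is not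
supercuspidal, so (NCB) is principal-series local–global compatibility (Deligne 1973 ∕ Langlands 1973, pre-Carayol), not Carayol (A).

CONTENT. §J ∕ §K ∕ §L = `Lines/jacquet.lean` rev 9 lines 95–1286 BYTE-IDENTICAL (Lines cannot import Lines; namespace renamed). §N NEW, sorry-free:
§N.1 (RAT)♮ `RationalCharacter` + `rationalCharacter_of_iso` VERBATIM from `Lines/weylsign.lean` e2115ac36e228efe (generation 15); §N.2 the four new
statements (JV_Q) `JacquetVectorDocked`, (JV₇) `JacquetVectorResidual`, (RCG) `RationalCuspidalGhost`, (CTT) `CuspidalTorusType`; §N.3 PROVED: `jacquetVectorDocked_of_free`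
((JV) ⟹ (JV_Q)), `jacquetVectorResidual_of_docked` ((JV_Q) ⟹ (JV₇)), `jacquetVectorDocked_of_ghost` ((IRR)♮ → (RAT)♮ → (RCG) → (JV₇) → (JV_Q)),
`borelCubicEigenDocking_of_ghost` ((JV_Q) → (NCB) → (LL) → (BCV): §L.5's proof with (JV) applied at `Q.form` only); §N.4 PROVED: `dvd_four_or_dvd_six_of_intTrace`
(Niven's step), `mod_four_eq_three_of_ghostOrder`, `rationalCuspidalGhost_of_type` ((CTT) → (RCG)). §4 the SEVEN stubs (the only sorries): (MO1), (RAT)♮, (CTT),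
(JV₇), (NCB), (CV♭), (DS) ∧ (JLᶜ). §5 the crux decls BY NAME: `CartanOnePlaceDegreeLawAtThree_of_ghost` ∕ `…'` ∕ `…_of_ghostType` ∕ `…Natural_of_ghost`,
`CartanOnePlaceDegreeLawAtThree_of_stubs` ∕ `_of_stubs'` through the TREE's `coverIsotypicComponent_of_lines'`, `splitFixedRankOne_of_multiplicityOne`,
`coverIsotypicIrreducible_of'`, `cubicCharacterTables` and the `CartanNaturalChain` closers — no `CartanSupplyCompositions` shortcut is needed.

NODE TAGS (D-0171): (JV_Q) DERIVED — NEW; (RCG) DERIVED from (CTT) — NEW (§N.4 PROVED: `ζ + ζ⁻¹ ∈ ℤ` ⟹ `n ∣ 4 ∨ n ∣ 6`; `3 ≤ n ∣ q + 1`, `q ≡ 1 (3)` ⟹ `n = 4`);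
(CTT) NEW · finite group theory at every prime `q` · ATTACKABLE in tree (the §F.6 pinning engine `cubicCuspidalCharacter_of_five_le` made `ν`-general:
`exists_irreducible_of_virtual_normOne`, `frobenius_reciprocity`, `exists_four_ne_zero`, `char_eq_of_pairing_ne_zero`, `torusInd_elliptic`) · a theorem of finite
group theory, true outright (James–Liebeck Thm. 28.5, row `χ_i`); (RAT)♮ generation 15 VERBATIM · WEAKER than (ISO)♮ (PROVED `rationalCharacter_of_iso`) · ATTACKABLE in tree
(cmrank real-form descent: `CMRank.trace_latticeRep_eq_cubicNewvectorChar`'s lattice branch); (JV₇) NEW as a statement = (JV_Q) ∧ `q % 4 = 3` · WEAKER than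
(JV_Q), (JV), (BCV), (ISO)♮ · UNDECIDED-in-tree ∕ INSTRUMENTABLE (Atkin–Li: a cubic twist of `f_V` of level `N∕q` at `q ∈ {7, 19, 31, 43, …}`; kit j342858 ∕
j342924 already PASS the cubic slice at every tested pair) ∕ IDEA-NEEDED in tree (print: «type ≠ ν₄», i.e. `e ≠ 4`; Carayol (A) or an `e`-detector);
(MO1), (NCB), (CV♭), (DS) ∧ (JLᶜ) VERBATIM rev 9 with rev 9's tags ((NCB) re-sourced to principal-series LGC, see line card). COSTUME check: no stub restates
the crux, NUM♮, (ISO)♮, (BCV) or a refuted statement; (JV₇) is a strict regime-restriction of a consumed leaf, (CTT) ∕ (RCG) are `V`-free. `Negative/LatticeLawLoadBearing`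
quantifies over `ℤ₍₃₎[G]`-lattices — untouched. Disproof §1 honoured: `Surj V 3` is a binder of (RAT)♮ ∕ (JV₇) ∕ (NCB) ∕ (CV♭) and is consumed by (LL) (§K) and
by (M)♮∕(OBS)♮ in the tree closer; `3 ∣ c_q` is a binder of every modular leaf and is where (JV₇)∕(NCB)∕(CV♭) get the type in print; (RCG) decides no type.

[cite: Bump1997, §4.1 Thm. 4.1.1 p. 406, Prop. 4.1.3, Prop. 4.1.6] [cite: FultonHarris1991, §5.2] [cite: Bump1997, Prop. 4.1.5, Prop. 4.1.6 p. 407] [cite: JamesLiebeck2001, Thm. 28.5]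
[cite: ShimuraIATAF1971, Thm. 8.4 p. 234] [cite: Langlands1973, Thm. 7.1] [cite: Deligne1973] [cite: Casselman1973, Thm. 1] [cite: Carayol1986, Thm. (A)] [cite: AtkinLi1978, Thm. 3.1]
[cite: Rohrlich1993, Prop. 2] [cite: DokchitserDokchitser2010, §3 Case 4c p. 14] [cite: DeligneSerre1974, Thm. 6.1] [cite: JacquetLanglands1970, Thm. 16.1]
-/


set_option linter.dupNamespace false
set_option autoImplicit false

noncomputable section

open scoped Classical MatrixGroups
open Matrix
namespace Summit.BirchSwinnertonDyer.BirchSwinnertonDyer.Cruxes.CartanOnePlaceDegreeLawAtThree.Ghost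

open Summit.BirchSwinnertonDyer.BirchSwinnertonDyer.Theorems
open Summit.BirchSwinnertonDyer.BirchSwinnertonDyer.Theorems.CartanDegree (HasRatEigenvalue)
open Summit.BirchSwinnertonDyer.BirchSwinnertonDyer.Theorems.CartanTorusCubeCut (torusSubgroup mem_torusSubgroup lin linGL
  linGL_coe lin_comm torusSubgroup_isCyclic card_torusSubgroup)
open Summit.BirchSwinnertonDyer.BirchSwinnertonDyer.Theorems.CartanCover (splitGen mem_splitTorus_iff)
open Summit.BirchSwinnertonDyer.BirchSwinnertonDyer.Theorems.CartanCover.Charext.InertHecke (upperUnip lowerUnip coe_upperUnip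
  coe_lowerUnip upperUnip_mul upperUnip_zero exists_unip_factorization)
open scoped Pointwise ModularForm NumberField
open Module UpperHalfPlane
open Literature.NumberTheory.Automorphic WeierstrassCurve Literature.NumberTheory.EllipticCurves Literature.NumberTheory.EllipticCurves.ModularForms
open Literature.NumberTheory.EllipticCurves.Rank1Residual Summit.BirchSwinnertonDyer.Rank1Residual Literature.NumberTheory.GaloisRepresentations NumberField IsDedekindDomain
open Summit.BirchSwinnertonDyer.BirchSwinnertonDyer.Theorems.CartanCover
open Summit.BirchSwinnertonDyer.BirchSwinnertonDyer.Theorems.CartanCover.CMRank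
open Summit.BirchSwinnertonDyer.BirchSwinnertonDyer.Theorems.CartanTorusCubeCut
open Summit.BirchSwinnertonDyer.BirchSwinnertonDyer.Theorems.CartanNaturalChain
open Summit.BirchSwinnertonDyer.BirchSwinnertonDyer.Theorems.CartanDegree (cubicNewvectorChar HasRatEigenvalue)
open Summit.BirchSwinnertonDyer.BirchSwinnertonDyer.Theorems.CartanDoubleCoset

/-! §J ∕ §K ∕ §L below (file lines up to `end Jacquet`) are `Lines/jacquet.lean` rev 9 (46f023ee71649e4c) lines 95–1286 BYTE-IDENTICAL. -/

/-! ## §J Generation 23's TYPE CUT §J.1–§J.5 and generation 24's §K, verbatim (`Lines/typecut.lean` 0f93f9bf2614071f via `Lines/conductor.lean` d7cda6432e8393bc, whose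
`section TypeCut` is copied BYTE-IDENTICALLY below under this namespace — Lines cannot import Lines; the §A–§I names it uses resolve to the tree's `…Theorems.CartanDoubleCoset`) -/

section TypeCut

/-! ### §J.1 PROVED (finite group theory): `P² = 1`, Bruhat, character separation on the diagonal torus, THE BOREL EIGENLINE -/

section BorelLine

variable {q : ℕ} [Fact q.Prime]

/-- `P² = 1`. -/
theorem weylP_mul_weylP : (weylP : GL (Fin 2) (ZMod q)) * weylP = 1 := by
  apply Units.ext
  rw [Units.val_mul, coe_weylP, Units.val_one]
  ext i j
  fin_cases i <;> fin_cases j <;> simp [Matrix.mul_apply, Fin.sum_univ_two]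

/-- the Weyl conjugate `P h(c) P = diag(1, c)` of `h(c)`. -/
def diagL (c : (ZMod q)ˣ) : GL (Fin 2) (ZMod q) := weylP * diagU c * weylP

theorem coe_diagL (c : (ZMod q)ˣ) :
    ((diagL c : GL (Fin 2) (ZMod q)) : Matrix (Fin 2) (Fin 2) (ZMod q)) = !![1, 0; 0, (c : ZMod q)] := by
  rw [diagL, Units.val_mul, Units.val_mul, coe_weylP, coe_diagU]
  ext i j
  fin_cases i <;> fin_cases j <;> simp [Matrix.mul_apply, Fin.sum_univ_two]

theorem diagU_lower (c : (ZMod q)ˣ) : ((diagU c : GL (Fin 2) (ZMod q)) : Matrix (Fin 2) (Fin 2) (ZMod q)) 1 0 = 0 := by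
  rw [coe_diagU]; rfl

theorem diagL_lower (c : (ZMod q)ˣ) : ((diagL c : GL (Fin 2) (ZMod q)) : Matrix (Fin 2) (Fin 2) (ZMod q)) 1 0 = 0 := by
  rw [coe_diagL]; rfl

theorem upperUnip_lower (x : ZMod q) : ((upperUnip x : GL (Fin 2) (ZMod q)) : Matrix (Fin 2) (Fin 2) (ZMod q)) 1 0 = 0 := by
  rw [coe_upperUnip]; rfl

/-- THE TORUS COMMUTATION `h(c) · n(y) P = n(c y) P · h(c)^P`. -/
theorem diagU_mul_unip_weylP (c : (ZMod q)ˣ) (y : ZMod q) :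
    diagU c * (upperUnip y * weylP) = upperUnip ((c : ZMod q) * y) * weylP * diagL c := by
  rw [← mul_assoc, diagU_mul_unip, diagL, mul_assoc (upperUnip _) weylP, ← mul_assoc weylP (weylP * diagU c) weylP,
    ← mul_assoc weylP weylP (diagU c), weylP_mul_weylP, one_mul, mul_assoc]

/-- THE BRUHAT DECOMPOSITION: an element with non-zero lower-left entry is `n(x) · P · b` with `b` upper-triangular. -/
theorem bruhat_of_ne (g : GL (Fin 2) (ZMod q)) (h : (g : Matrix (Fin 2) (Fin 2) (ZMod q)) 1 0 ≠ 0) :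
    ∃ (x : ZMod q) (b : GL (Fin 2) (ZMod q)), (b : Matrix (Fin 2) (Fin 2) (ZMod q)) 1 0 = 0 ∧ g = upperUnip x * weylP * b := by
  set x : ZMod q := (g : Matrix (Fin 2) (Fin 2) (ZMod q)) 0 0 / (g : Matrix (Fin 2) (Fin 2) (ZMod q)) 1 0 with hx
  refine ⟨x, weylP * upperUnip (-x) * g, ?_, ?_⟩
  · have hxg : x * (g : Matrix (Fin 2) (Fin 2) (ZMod q)) 1 0 = (g : Matrix (Fin 2) (Fin 2) (ZMod q)) 0 0 := div_mul_cancel₀ _ h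
    rw [Units.val_mul, Units.val_mul, coe_weylP, coe_upperUnip]
    simp [Matrix.mul_apply, Fin.sum_univ_two]
    rw [← hxg]; ring
  · simp only [← mul_assoc]
    rw [mul_assoc (upperUnip x) weylP weylP, weylP_mul_weylP, mul_one, upperUnip_mul, add_neg_cancel, upperUnip_zero, one_mul]

variable {lam : GL (Fin 2) (ZMod q) → ℂ}

/-- a cubic Borel character is trivial on `N`. -/
theorem IsCubicBorelCharacter.unip (h : IsCubicBorelCharacter q lam) (x : ZMod q) : lam (upperUnip x) = 1 :=
  h.2.1 _ (upperUnip_lower x) ⟨1, one_ne_zero, by rw [coe_upperUnip]; simp⟩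

/-- **CHARACTER SEPARATION ON THE DIAGONAL TORUS**: a cubic Borel character `λ` differs from its Weyl conjugate at some `h(c)`:
`λ(h(c)) = x` with `x³ = 1`, `x ≠ 1`, and `λ(h(c)^P) = x⁻¹ ≠ x`. -/
theorem IsCubicBorelCharacter.exists_diagU_ne (h : IsCubicBorelCharacter q lam) :
    ∃ c : (ZMod q)ˣ, lam (diagU c) ≠ lam (diagL c) := by
  obtain ⟨hmul, hcube, t, h01, h10, hlt⟩ := h
  obtain ⟨c, hs01, hs10, hs00⟩ := diag_decomp t h01 h10
  refine ⟨c, fun heq => hlt ?_⟩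
  -- `t = h(c) · s` with `s` scalar-diagonal, `λ(s) = 1`, so `x := λ(h(c)) = λ(t)`
  have hs : lam ((diagU c)⁻¹ * t) = 1 := hcube _ hs10 ⟨1, one_ne_zero, by rw [one_pow, one_mul]; exact hs00⟩
  have ht : lam t = lam (diagU c) := by
    conv_lhs => rw [← mul_inv_cancel_left (diagU c) t]
    rw [hmul _ _ (diagU_lower c) hs10, hs, mul_one]
  -- `x³ = 1`
  have h3 : lam (diagU c) * lam (diagU c) * lam (diagU c) = 1 := by
    have hc3 : lam (diagU (c * c * c)) = 1 :=
      hcube _ (diagU_lower _) ⟨(c : ZMod q), c.ne_zero, by rw [coe_diagU]; simp; ring⟩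
    rw [← hmul _ _ (diagU_lower c) (diagU_lower c), diagU_mul, ← hmul _ _ (diagU_lower _) (diagU_lower c), diagU_mul]
    exact hc3
  -- `x · λ(h(c)^P) = λ(scalar c) = 1`
  have h2 : lam (diagU c) * lam (diagL c) = 1 := by
    have hprod : ((diagU c * diagL c : GL (Fin 2) (ZMod q)) : Matrix (Fin 2) (Fin 2) (ZMod q)) = !![(c : ZMod q), 0; 0, (c : ZMod q)] := by
      rw [Units.val_mul, coe_diagU, coe_diagL]
      ext i j
      fin_cases i <;> fin_cases j <;> simp [Matrix.mul_apply, Fin.sum_univ_two]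
    rw [← hmul _ _ (diagU_lower c) (diagL_lower c)]
    refine hcube _ ?_ ⟨1, one_ne_zero, ?_⟩
    · rw [hprod]; rfl
    · rw [hprod]; simp
  -- if `x = λ(h(c)^P)` then `x² = 1 = x³`, so `x = 1`
  rw [← heq] at h2
  rw [ht]
  calc lam (diagU c) = lam (diagU c) * (lam (diagU c) * lam (diagU c)) := by rw [h2, mul_one]
    _ = 1 := by rw [← mul_assoc]; exact h3

/-- **(BLINE) THE BOREL EIGENLINE** [PROVED, any `ℂ[GL₂(𝔽_q)]`-module]: in the `G`-span of a `(B, λ)`-eigenvector `v` (`λ` cubic Borel) every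
`(B, λ)`-eigenvector is a multiple of `v` (Bruhat + `N`-average + torus character separation; Mackey's `⟨Res_B Ind_B^G λ, λ⟩ = 1` vector-wise). -/
theorem borelLine {W : Type*} [AddCommGroup W] [Module ℂ W] (ρ : Representation ℂ (GL (Fin 2) (ZMod q)) W)
    (hlam : IsCubicBorelCharacter q lam) {v : W}
    (hv : ∀ b : GL (Fin 2) (ZMod q), (b : Matrix (Fin 2) (Fin 2) (ZMod q)) 1 0 = 0 → ρ b v = lam b • v)
    {u : W} (hu : u ∈ Submodule.span ℂ (Set.range fun g : GL (Fin 2) (ZMod q) => ρ g v))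
    (hub : ∀ b : GL (Fin 2) (ZMod q), (b : Matrix (Fin 2) (Fin 2) (ZMod q)) 1 0 = 0 → ρ b u = lam b • u) :
    ∃ a : ℂ, u = a • v := by
  obtain ⟨c, hc⟩ := IsCubicBorelCharacter.exists_diagU_ne hlam
  have hq0 : (q : ℂ) ≠ 0 := by exact_mod_cast (Fact.out : q.Prime).ne_zero
  -- the Bruhat vectors `v_x = n(x) P v` and their sum `s`
  set vx : ZMod q → W := fun x => ρ (upperUnip x * weylP) v with hvx
  set s : W := ∑ x : ZMod q, vx x with hs
  -- (1) Bruhat: `ℂ[G] v ≤ span (v, v_x)`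
  have hspan : Submodule.span ℂ (Set.range fun g : GL (Fin 2) (ZMod q) => ρ g v) ≤ Submodule.span ℂ (insert v (Set.range vx)) := by
    refine Submodule.span_le.mpr ?_
    rintro _ ⟨g, rfl⟩
    show ρ g v ∈ Submodule.span ℂ (insert v (Set.range vx))
    by_cases hg : (g : Matrix (Fin 2) (Fin 2) (ZMod q)) 1 0 = 0
    · rw [hv g hg]
      exact Submodule.smul_mem _ _ (Submodule.subset_span (Set.mem_insert _ _))
    · obtain ⟨x, b, hb, rfl⟩ := bruhat_of_ne g hg
      rw [map_mul, Module.End.mul_apply, hv b hb, map_smul]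
      exact Submodule.smul_mem _ _ (Submodule.subset_span (Set.mem_insert_of_mem _ ⟨x, rfl⟩))
  -- (2) the `N`-average
  set A : W →ₗ[ℂ] W := ∑ y : ZMod q, ρ (upperUnip y) with hA
  have hA_apply : ∀ w : W, A w = ∑ y : ZMod q, ρ (upperUnip y) w := fun w => by
    simp [hA, LinearMap.sum_apply]
  have hA_eig : ∀ w : W, (∀ b : GL (Fin 2) (ZMod q), (b : Matrix (Fin 2) (Fin 2) (ZMod q)) 1 0 = 0 → ρ b w = lam b • w) →
      A w = (q : ℂ) • w := by
    intro w hw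
    rw [hA_apply]
    have h1 : ∀ y : ZMod q, ρ (upperUnip y) w = w := fun y => by rw [hw _ (upperUnip_lower y), IsCubicBorelCharacter.unip hlam y, one_smul]
    simp_rw [h1]
    rw [Finset.sum_const, Finset.card_univ, ZMod.card, ← Nat.cast_smul_eq_nsmul ℂ]
  have hA_vx : ∀ x : ZMod q, A (vx x) = s := by
    intro x
    rw [hA_apply]
    have h1 : ∀ y : ZMod q, ρ (upperUnip y) (vx x) = vx (y + x) := fun y => by
      simp only [hvx]
      rw [← Module.End.mul_apply, ← map_mul, ← mul_assoc, upperUnip_mul]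
    simp_rw [h1]
    exact Fintype.sum_equiv (Equiv.addRight x) _ _ (fun y => rfl)
  -- (3) `A u ∈ span {v, s}`
  have hAu : A u ∈ Submodule.span ℂ ({v, s} : Set W) := by
    have hle : (Submodule.span ℂ (insert v (Set.range vx))).map A ≤ Submodule.span ℂ ({v, s} : Set W) := by
      rw [Submodule.map_span_le]
      rintro w (rfl | ⟨x, rfl⟩)
      · rw [hA_eig _ hv]
        exact Submodule.smul_mem _ _ (Submodule.subset_span (by simp))
      · rw [hA_vx]
        exact Submodule.subset_span (by simp)
    exact hle ⟨u, hspan hu, rfl⟩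
  obtain ⟨a', b', hab⟩ := Submodule.mem_span_pair.mp hAu
  -- (4) `u = a v + b s`
  have hu_eq : u = ((q : ℂ)⁻¹ * a') • v + ((q : ℂ)⁻¹ * b') • s := by
    have h1 : (q : ℂ) • u = a' • v + b' • s := by rw [← hA_eig u hub, hab]
    calc u = (q : ℂ)⁻¹ • ((q : ℂ) • u) := by rw [smul_smul, inv_mul_cancel₀ hq0, one_smul]
      _ = _ := by rw [h1, smul_add, smul_smul, smul_smul]
  set a : ℂ := (q : ℂ)⁻¹ * a'
  set b : ℂ := (q : ℂ)⁻¹ * b'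
  -- (5) the diagonal torus: `h(c) v = λ(h(c)) v`, `h(c) s = λ(h(c)^P) s`
  have hts : ρ (diagU c) s = lam (diagL c) • s := by
    rw [hs, map_sum, Finset.smul_sum]
    have h1 : ∀ y : ZMod q, ρ (diagU c) (vx y) = lam (diagL c) • vx ((c : ZMod q) * y) := fun y => by
      simp only [hvx]
      rw [← Module.End.mul_apply, ← map_mul, diagU_mul_unip_weylP, map_mul, Module.End.mul_apply, hv _ (diagL_lower c), map_smul]
    simp_rw [h1]
    rw [← Equiv.sum_comp (Units.mulLeft c) (fun y : ZMod q => lam (diagL c) • vx y)]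
    rfl
  have htu := hub _ (diagU_lower c)
  rw [hu_eq, map_add, map_smul, map_smul, hv _ (diagU_lower c), hts] at htu
  have key : (b * (lam (diagU c) - lam (diagL c))) • s = 0 := by
    have e : (b * (lam (diagU c) - lam (diagL c))) • s =
        -(a • lam (diagU c) • v + b • lam (diagL c) • s - lam (diagU c) • (a • v + b • s)) := by
      module
    rw [e, htu, sub_self, neg_zero]
  rcases smul_eq_zero.mp key with hb | hs0
  · rcases mul_eq_zero.mp hb with hb | hb
    · exact ⟨a, by rw [hu_eq, hb, zero_smul, add_zero]⟩
    · exact absurd (sub_eq_zero.mp hb) hc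
  · exact ⟨a, by rw [hu_eq, hs0, smul_zero, add_zero]⟩

end BorelLine

/-! ### §J.2 PROVED: eigen-components along a stable direct sum, and (BGEN) «a Borel eigenline whose `G`-span MEETS a stable submodule lies in it» -/

variable {D M : ℕ} {C : Finset ℕ} {X : CartanLevelCurveData D M C} {q : ℕ} [Fact q.Prime]

/-- **THE COMMUTATOR TRICK for eigenvectors** (`fixed_components` with an eigenvalue): if `u₁ + u₂` is a `c`-eigenvector of `t`, `u₁ ∈ σ`, `u₂ ∈ σ'`, both
`G`-stable with `σ ⊓ σ' = ⊥`, then so are `u₁` and `u₂`. -/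
theorem eigen_components (R : CoverReduction X q) {σ σ' : Submodule ℂ R.IndCuspForm}
    (hσ : ∀ g : GL (Fin 2) (ZMod q), ∀ F ∈ σ, R.indRep g F ∈ σ) (hσ' : ∀ g : GL (Fin 2) (ZMod q), ∀ F ∈ σ', R.indRep g F ∈ σ')
    (hinf : σ ⊓ σ' = ⊥) {u₁ u₂ : R.IndCuspForm} (hu₁ : u₁ ∈ σ) (hu₂ : u₂ ∈ σ') {t : GL (Fin 2) (ZMod q)} {c : ℂ}
    (ht : R.indRep t (u₁ + u₂) = c • (u₁ + u₂)) : R.indRep t u₁ = c • u₁ ∧ R.indRep t u₂ = c • u₂ := by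
  rw [map_add, smul_add] at ht
  have h1 : R.indRep t u₁ - c • u₁ ∈ σ := Submodule.sub_mem _ (hσ t u₁ hu₁) (Submodule.smul_mem _ _ hu₁)
  have h2 : c • u₂ - R.indRep t u₂ ∈ σ' := Submodule.sub_mem _ (Submodule.smul_mem _ _ hu₂) (hσ' t u₂ hu₂)
  have he : R.indRep t u₁ - c • u₁ = c • u₂ - R.indRep t u₂ := by
    rw [sub_eq_sub_iff_add_eq_add, ht]
    exact add_comm _ _
  have hmem : R.indRep t u₁ - c • u₁ ∈ σ ⊓ σ' := ⟨h1, he ▸ h2⟩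
  rw [hinf, Submodule.mem_bot, sub_eq_zero] at hmem
  refine ⟨hmem, ?_⟩
  have h3 : c • u₂ - R.indRep t u₂ = 0 := by rw [← he, hmem, sub_self]
  exact (sub_eq_zero.mp h3).symm

/-- **(BGEN) THE BOREL EIGENLINE MEETS ⟹ LIES IN** [PROVED]: `v` a `(B, λ)`-eigenvector (`λ` cubic Borel) of the induced module, `Y` a `G`-stable subspace;
if `ℂ[G]·v ⊓ Y ≠ 0` then `v ∈ Y` (Maschke complement of `ℂ[G]·v ⊓ Y`, `eigen_components`, (BLINE)). -/
theorem mem_of_borelLine_meets (R : CoverReduction X q) {lam : GL (Fin 2) (ZMod q) → ℂ} (hlam : IsCubicBorelCharacter q lam)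
    {v : R.IndCuspForm} (hv : ∀ b : GL (Fin 2) (ZMod q), (b : Matrix (Fin 2) (Fin 2) (ZMod q)) 1 0 = 0 → R.indRep b v = lam b • v)
    {Y : Submodule ℂ R.IndCuspForm} (hY : ∀ g : GL (Fin 2) (ZMod q), ∀ F ∈ Y, R.indRep g F ∈ Y)
    {u : R.IndCuspForm} (huU : u ∈ R.spanG v) (huY : u ∈ Y) (hu0 : u ≠ 0) : v ∈ Y := by
  haveI : NeZero ((Nat.card (GL (Fin 2) (ZMod q)) : ℂ)) := ⟨Nat.cast_ne_zero.mpr Nat.card_pos.ne'⟩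
  have hUst : ∀ g : GL (Fin 2) (ZMod q), ∀ F ∈ R.spanG v, R.indRep g F ∈ R.spanG v := fun g F hF => R.indRep_mem_spanG v g hF
  have hσst : ∀ g : GL (Fin 2) (ZMod q), ∀ F ∈ R.spanG v ⊓ Y, R.indRep g F ∈ R.spanG v ⊓ Y :=
    fun g F hF => ⟨hUst g F hF.1, hY g F hF.2⟩
  let σ : Subrepresentation R.indRep := ⟨R.spanG v ⊓ Y, fun g F hF => hσst g F hF⟩
  obtain ⟨σ', hc⟩ := exists_isCompl σ
  have hinf : (R.spanG v ⊓ Y) ⊓ σ'.toSubmodule = ⊥ := congrArg Subrepresentation.toSubmodule hc.inf_eq_bot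
  have hsup : (R.spanG v ⊓ Y) ⊔ σ'.toSubmodule = ⊤ := congrArg Subrepresentation.toSubmodule hc.sup_eq_top
  have hvtop : v ∈ (R.spanG v ⊓ Y) ⊔ σ'.toSubmodule := by rw [hsup]; exact Submodule.mem_top
  obtain ⟨y, hy, z, hz, hsum⟩ := Submodule.mem_sup.mp hvtop
  have hσ'st : ∀ g : GL (Fin 2) (ZMod q), ∀ F ∈ σ'.toSubmodule, R.indRep g F ∈ σ'.toSubmodule :=
    fun g F hF => σ'.apply_mem_toSubmodule g hF
  -- `y` is a `(B, λ)`-eigenvector in `ℂ[G]·v`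
  have hyb : ∀ b : GL (Fin 2) (ZMod q), (b : Matrix (Fin 2) (Fin 2) (ZMod q)) 1 0 = 0 → R.indRep b y = lam b • y :=
    fun b hb => (eigen_components R hσst hσ'st hinf hy hz (by rw [hsum]; exact hv b hb)).1
  obtain ⟨a, ha⟩ := borelLine R.indRep hlam hv hy.1 hyb
  by_cases ha0 : a = 0
  · exfalso
    rw [ha0, zero_smul] at ha
    have hvz : v ∈ σ'.toSubmodule := by rw [← hsum, ha, zero_add]; exact hz
    have hle : R.spanG v ≤ σ'.toSubmodule := spanG_le_of_mem R hσ'st hvz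
    have hmem : u ∈ (R.spanG v ⊓ Y) ⊓ σ'.toSubmodule := ⟨⟨huU, huY⟩, hle huU⟩
    rw [hinf, Submodule.mem_bot] at hmem
    exact hu0 hmem
  · have hva : v = a⁻¹ • y := by rw [ha, smul_smul, inv_mul_cancel₀ ha0, one_smul]
    rw [hva]
    exact Submodule.smul_mem _ _ hy.2

/-! ### §J.3 PROVED: a `T_s`-fixed vector of an `a_ℓ(V)`-eigenmodule of the family `𝒯♭` (§I) is the docking of an `a_ℓ(V)`-eigenform of split-Cartan level
(the first half of `fixed_dependent_of_eigenModuleFn`: FIX ⟹ DOCK by strong approximation + the iff-docking (iii♭)) -/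

theorem exists_eigenform_of_fixed {V : WeierstrassCurve ℚ} [V.IsElliptic] (hq : q ∈ C) (R : CoverReduction X q)
    (Os : Submodule ℤ X.B) (hOs : Brandt.IsOrder X.B Os)
    (𝒯 : ℕ → (R.IndCuspForm →ₗ[ℂ] (GL (Fin 2) (ZMod q) → ℍ → ℂ)))
    (hiii : ∀ ℓ : ℕ, ℓ.Prime → ¬ ℓ ∣ q * (D * M * ∏ p ∈ C, p) →
        ∀ (F : CuspForm (R.levelOf (CartanTorusCubeCut.torusSubgroup (splitGen q))) 2) (a : ℂ),
          (unitsHeckeFun X.ι hOs ℓ (⇑F) = fun τ => a * F τ) ↔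
            𝒯 ℓ (R.dockTorus (CartanTorusCubeCut.torusSubgroup (splitGen q)) F) =
              a • coeLin R (R.dockTorus (CartanTorusCubeCut.torusSubgroup (splitGen q)) F))
    (𝓜 : Submodule ℂ R.IndCuspForm)
    (h𝓜 : ∀ ℓ : ℕ, ℓ.Prime → ¬ ℓ ∣ q * (D * M * ∏ p ∈ C, p) → ∀ w ∈ 𝓜, 𝒯 ℓ w = (((V.LFunction ℓ : ℤ)) : ℂ) • coeLin R w)
    {w : R.IndCuspForm} (hw : w ∈ 𝓜) (hfix : ∀ t ∈ CartanTorusCubeCut.torusSubgroup (splitGen q), R.indRep t w = w) :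
    ∃ F : CuspForm (R.levelOf (CartanTorusCubeCut.torusSubgroup (splitGen q))) 2,
      w = R.dockTorus (CartanTorusCubeCut.torusSubgroup (splitGen q)) F ∧
      ∀ ℓ : ℕ, ℓ.Prime → ¬ ℓ ∣ q * (D * M * ∏ p ∈ C, p) →
        unitsHeckeFun X.ι hOs ℓ (⇑F) = fun τ => ((V.LFunction ℓ : ℤ) : ℂ) * F τ := by
  have hfull : ∀ g, g ∈ R.torusCoset (CartanTorusCubeCut.torusSubgroup (splitGen q)) := mem_torusCoset_split R hq
  refine ⟨fixedForm R _ w hfix, eq_dockTorus_of_fixed R _ hfull w hfix, fun ℓ hℓ hnd => ?_⟩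
  apply (hiii ℓ hℓ hnd _ _).mpr
  rw [← eq_dockTorus_of_fixed R _ hfull w hfix]
  exact h𝓜 ℓ hℓ hnd w hw

/-! ### §J.4 Generation 23's three `Q`-free statements (verbatim): (PSV) and (CV♭) stay leaves (stubs in §4); (LL) is PROVED in §K -/

/-- **(PSV) CUBIC PRINCIPAL-SERIES VECTOR at `q ≡ 1 (3)`** [NEW LEAF; local–global, principal-series regime; `Q`-FREE; INSTRUMENTABLE; print =
Tate (`3 ∣ c_q`, `q ∤ 6N/q²` ⟹ IV ∕ IV*, tame inertia of order `3`) + local Langlands (`π_{V,q} ≅ PS(χ₃ε, χ₃⁻¹ε⁻¹)`) + local–global compatibility + the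
ONE-dimensional `T_s`-fixed line of `π^{K(q)} ≅ Ind_B^G(χ₃ ⊠ χ₃⁻¹)` (Mackey, three `(B, T_s)` double cosets) — NO multiplicity one off `q`]. Under the crux's
binders at `q` and a presentation of a split order `O_s`: there are a cubic Borel character `λ`, a NON-ZERO `(B, λ)`-eigenvector `v` of the induced module and
a NON-ZERO `a_ℓ(V)`-eigenform `F` of split-Cartan level (`T_ℓ^{O_s}`, good `ℓ`) whose diagonal-torus docking lies in `ℂ[G]·v` (print: the docking is a pure
tensor `x₀ ⊗ m`, `v := v₀ ⊗ m`). NO `Q`, NO `IsMinimalFor`. Why it might fail: only through a mismatch between the tree's `unitsHeckeFun` ∕ `dockTorus`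
conventions and the adelic newvector. [cite: Langlands1973, Thm. 7.1] [cite: Carayol1986, Thm. (A)] [cite: AtkinLi1978, Thm. 3.1] [cite: Rohrlich1993, Prop. 2]
[cite: DokchitserDokchitser2010, §3 Case 4c p. 14] [cite: Bump1997, Thm. 4.1.1] [cite: LoefflerWeinstein2011, Thm. 1.1] -/
def CubicPrincipalSeriesVector : Prop :=
  ∀ (V : WeierstrassCurve ℚ) [V.IsElliptic] [V.IsGloballyMinimal], Surj V 3 →
    ∀ (N D M : ℕ) (C : Finset ℕ) (q : ℕ) [Fact q.Prime]
      (X : CartanLevelCurveData D M C) (hq : q ∈ C) (R : CoverReduction X q),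
      V.conductorNorm ℤ = N → D * M * ∏ p ∈ C, p ^ 2 = N → q ≠ 3 → ¬ q ^ 3 ∣ N →
      3 ∣ (V.baseChange ℚ_[q]).localTamagawaNumber ℤ_[q] → q % 3 = 1 →
      ∀ (Os : Submodule ℤ X.B) (hOs : Brandt.IsOrder X.B Os),
        (∀ m : Matrix (Fin 2) (Fin 2) ℝ, (∃ x ∈ Os, X.ι x = m) ↔
          ∃ y : coverSubring X q, (R.red y) 0 1 = 0 ∧ (R.red y) 1 0 = 0 ∧ X.ι (y : X.B) = m) →
        ∃ (lam : GL (Fin 2) (ZMod q) → ℂ) (v : R.IndCuspForm)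
          (F : CuspForm (R.levelOf (CartanTorusCubeCut.torusSubgroup (splitGen q))) 2),
          v ≠ 0 ∧ IsCubicBorelCharacter q lam ∧
          (∀ b : GL (Fin 2) (ZMod q), (b : Matrix (Fin 2) (Fin 2) (ZMod q)) 1 0 = 0 → R.indRep b v = lam b • v) ∧
          F ≠ 0 ∧
          (∀ ℓ : ℕ, ℓ.Prime → ¬ ℓ ∣ q * (D * M * ∏ p ∈ C, p) →
            unitsHeckeFun X.ι hOs ℓ (⇑F) = fun τ => ((V.LFunction ℓ : ℤ) : ℂ) * F τ) ∧
          R.dockTorus (CartanTorusCubeCut.torusSubgroup (splitGen q)) F ∈ R.spanG v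

/-- **(LL) NO COVER-INVARIANT `V`-EIGENFORM** [leaf of generation 23 — PROVED IN THIS NODE (§K.4 `noCoverInvariantEigenform_of_facts`, from (DS) ∧ (JLᶜ));
statement verbatim; generation 23's gloss follows: modular; `Q`-FREE, TYPE-FREE, regime-free; ATTACKABLE: (JLᶜ) `jacquetLanglands_cartanCover_newform`
moves a good-Hecke eigenform of level `ι(O₀'¹)` to a classical newform of level `∣ D·M·∏_{C∖q} p²` (prime to `q`); `V` is modular of conductor `N`, `q² ∣ N`
(`exists_isNewformOf`, `IsNewformOf.level_eq_conductorNorm`); strong multiplicity one + isogeny-invariance of the conductor — no level-lowering at exponent `2`].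
Under the crux's binders: an `a_ℓ(V)`-eigenform of split-Cartan level whose restriction to `Γ̄(q)` is invariant under the whole cover unit group `O₀'¹` is ZERO.
Why it might fail: only if `unitsHeckeFun` at level `O_s` and at level `O₀'` disagree on `O₀'¹`-invariant forms at some good `ℓ` (coset bookkeeping), making
(JLᶜ) inapplicable as typed. [cite: JacquetLanglands1970, Thm. 16.1] [cite: Carayol1986, Thm. (A)] [cite: DiamondShurman2005, Thm. 5.8.2] [cite: AtkinLehner1970, Thm. 5] -/
def NoCoverInvariantEigenform : Prop :=
  ∀ (V : WeierstrassCurve ℚ) [V.IsElliptic] [V.IsGloballyMinimal], Surj V 3 →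
    ∀ (N D M : ℕ) (C : Finset ℕ) (q : ℕ) [Fact q.Prime]
      (X : CartanLevelCurveData D M C) (hq : q ∈ C) (R : CoverReduction X q),
      V.conductorNorm ℤ = N → D * M * ∏ p ∈ C, p ^ 2 = N → q ≠ 3 → ¬ q ^ 3 ∣ N →
      3 ∣ (V.baseChange ℚ_[q]).localTamagawaNumber ℤ_[q] →
      ∀ (Os : Submodule ℤ X.B) (hOs : Brandt.IsOrder X.B Os),
        (∀ m : Matrix (Fin 2) (Fin 2) ℝ, (∃ x ∈ Os, X.ι x = m) ↔
          ∃ y : coverSubring X q, (R.red y) 0 1 = 0 ∧ (R.red y) 1 0 = 0 ∧ X.ι (y : X.B) = m) →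
        ∀ F : CuspForm (R.levelOf (CartanTorusCubeCut.torusSubgroup (splitGen q))) 2,
          (∀ ℓ : ℕ, ℓ.Prime → ¬ ℓ ∣ q * (D * M * ∏ p ∈ C, p) →
            unitsHeckeFun X.ι hOs ℓ (⇑F) = fun τ => ((V.LFunction ℓ : ℤ) : ℂ) * F τ) →
          (∀ γ : coverUnits X q,
            coverRep X q γ (R.restrictLevel (CartanTorusCubeCut.torusSubgroup (splitGen q)) F) =
              R.restrictLevel (CartanTorusCubeCut.torusSubgroup (splitGen q)) F) →
          F = 0

/-- **(CV♭) NON-SPLIT CUBIC VANISHING, `Q`-FREE, at `q ≡ 2 (3)`** [NEW LEAF; local–global, cuspidal regime; UNDECIDED ∕ BARRIER(print) = supercuspidal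
local–global compatibility: `3 ∣ c_q`, `q ≡ 2 (3)` ⟹ `π_{V,q} = π(θ₃)` of depth zero and `Res_{T_η} π(θ₃)^{K(q)}` omits exactly the cubic characters `θ₃^{±1}`;
INSTRUMENTABLE]. Under the crux's binders: if `v` is a `T_η`-eigenvector with a CUBIC torus character and `ℂ[G]·v` contains the diagonal docking of a NON-ZERO
`a_ℓ(V)`-eigenform of split-Cartan level, then `v = 0` (print: the `G`-equivariant good-Hecke projection of `v` to the `V`-part is cubic `T_η`-eigen, hence `0`,
yet its span contains the docking). NO `Q`, NO `IsMinimalFor`, NO irreducibility. Why it might fail: a cubic `T_η`-eigenvector OUTSIDE the `V`-part whose span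
contains a `V`-eigen docking — excluded in print by the Hecke-isotypic decomposition of the induced module (semisimplicity), not yet in tree at level `Γ̄(q)`.
[cite: Carayol1986, Thm. (A)] [cite: JamesLiebeck2001, Thm. 28.5] [cite: Tunnell1983, Thm. p. 1277] [cite: Rohrlich1993, Prop. 2] [cite: LoefflerWeinstein2011, Thm. 1.1]
[cite: Bump1997, Prop. 4.1.6] -/
def NonsplitCubicVanishingFree : Prop :=
  ∀ (V : WeierstrassCurve ℚ) [V.IsElliptic] [V.IsGloballyMinimal], Surj V 3 →
    ∀ (N D M : ℕ) (C : Finset ℕ) (q : ℕ) [Fact q.Prime]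
      (X : CartanLevelCurveData D M C) (hq : q ∈ C) (R : CoverReduction X q),
      V.conductorNorm ℤ = N → D * M * ∏ p ∈ C, p ^ 2 = N → q ≠ 3 → ¬ q ^ 3 ∣ N →
      3 ∣ (V.baseChange ℚ_[q]).localTamagawaNumber ℤ_[q] → q % 3 = 2 →
      ∀ (Os : Submodule ℤ X.B) (hOs : Brandt.IsOrder X.B Os),
        (∀ m : Matrix (Fin 2) (Fin 2) ℝ, (∃ x ∈ Os, X.ι x = m) ↔
          ∃ y : coverSubring X q, (R.red y) 0 1 = 0 ∧ (R.red y) 1 0 = 0 ∧ X.ι (y : X.B) = m) →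
        ∀ (ν : GL (Fin 2) (ZMod q) → ℂ) (v : R.IndCuspForm)
          (F : CuspForm (R.levelOf (CartanTorusCubeCut.torusSubgroup (splitGen q))) 2),
          IsCubicTorusCharacter R.η ν →
          (∀ t ∈ CartanTorusCubeCut.torusSubgroup R.η, R.indRep t v = ν t • v) →
          F ≠ 0 →
          (∀ ℓ : ℕ, ℓ.Prime → ¬ ℓ ∣ q * (D * M * ∏ p ∈ C, p) →
            unitsHeckeFun X.ι hOs ℓ (⇑F) = fun τ => ((V.LFunction ℓ : ℤ) : ℂ) * F τ) →
          R.dockTorus (CartanTorusCubeCut.torusSubgroup (splitGen q)) F ∈ R.spanG v →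
          v = 0


/-! ### §K PROVED (generation 24, NEW): (LL) IS NOT A LEAF — `NoCoverInvariantEigenform` from (JLᶜ) ∧ (DS) by a CONDUCTOR ∕ RAMIFICATION contradiction -/

/-! #### §K.1 The Galois contradiction: no newform of level prime to the Cartan place `q` has `a_ℓ(f) = a_ℓ(V)` at almost all primes -/

section Galois

open CongruenceSubgroup Rat.HeightOneSpectrum

/-- **No newform of level prime to `q` is good-Hecke congruent (indeed equal) to `V` — residual form.** For ANY discrete field `k` receiving `j : 𝔽₃ → k` and a
coefficient map `ι_f : 𝓞_f → k`: if `f ∈ S₂(Γ₁(M_f))` is a newform with trivial character, `q ∤ M_f`, and `a_ℓ(f) = a_ℓ(V)` for all primes `ℓ` outside a finite set, then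
`False`. Deligne's `ρ_{f}` reduced along `ι_f` is semisimple, unramified outside `3 M_f`, with Frobenius polynomials `X² − ι_f(a_ℓ) X + ℓ`
(`DeligneSerre1974.exists_isGaloisRepOfNewform1Int_semisimple_of_thm61`); `ρ̄_{V,3} ⊗_j k` is semisimple (`Surj V 3`, `CartanCarayol.isSemisimple_baseChange_of_surj`) with the
same polynomials at the good places (`CartanCarayol.hasFrobCharpolyAt_baseChange_of_isTorsionGaloisRep`, `a_{ℓ_v}(V) = a_v(V)`, `#k_v = ℓ_v`); Brauer–Nesbitt–Čebotarev
(`FramedGaloisRep.nonempty_equiv_of_hasFrobCharpolyAt_eventually_of_discrete'`) makes them isomorphic, so `ρ̄_{V,3} ⊗ k` is unramified at the place over `q` — but `q ∈ C` is a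
place of ADDITIVE reduction (`CartanCarayol.hasAdditiveReductionAt_of_mem_cartanPlaces`, `IsTorsionGaloisRep.not_isUnramifiedAt_baseChange_of_hasAdditiveReductionAt`).
The characteristic-zero shadow of the tree's `CartanCarayol.modular_of_congruentNewform` ∘ `noModThreePeriodCharacterExtension_of_modular`.
[cite: DeligneSerre1974, Thm. 6.1] [cite: Serre1987, §1.2, (1.2.1)–(1.2.2)] [cite: SilvermanAEC2009, Thm. VII.6.1] [cite: DarmonDiamondTaylor1995, §2.1] -/
theorem false_of_newform_coeff_eq_lFunction_residual (h61 : DeligneSerre1974.thm61_exists_adicGaloisRep)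
    {V : WeierstrassCurve ℚ} [V.IsElliptic] (hS : Surj V 3)
    {N D M : ℕ} {C : Finset ℕ} {q : ℕ} [Fact q.Prime]
    (hq : q ∈ C) (hN : V.conductorNorm ℤ = N) (hDMC : D * M * ∏ p ∈ C, p ^ 2 = N) (hq3 : q ≠ 3)
    {Mf : ℕ} [NeZero Mf] {f : CuspForm (Gamma1 Mf) 2} (hf : IsNewform1 f) (hε : nebentypus f = 1) (hqMf : ¬ q ∣ Mf)
    (S : Finset ℕ) (hcoef : ∀ ℓ : ℕ, ℓ.Prime → ℓ ∉ S → (qExpansion 1 ⇑f).coeff ℓ = ((V.LFunction ℓ : ℤ) : ℂ))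
    (k : Type) [Field k] [TopologicalSpace k] [DiscreteTopology k] (j : ZMod 3 →+* k) (ιf : ↥(coeffCharIntegers f) →+* k) : False := by
  classical
  have hqp : q.Prime := Fact.out
  haveI : NumberField (coeffCharField f) := Literature.NumberTheory.EllipticCurves.GreenbergSelmer.numberField_coeffCharField_of_isNewform1 hf
  haveI : CharP k 3 := charP_of_injective_ringHom j.injective 3
  -- § the two mod-`3` Galois representations
  obtain ⟨ρ, hρ⟩ := V.exists_isTorsionGaloisRep 3
  obtain ⟨ρf, hgalf, hssf⟩ :=
    DeligneSerre1974.exists_isGaloisRepOfNewform1Int_semisimple_of_thm61 h61 le_rfl hf 3 ιf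
  have hssV := CartanCarayol.isSemisimple_baseChange_of_surj hS hρ k j
  -- § the cofinite conditions: good reduction, `v ∤ 3`, `ℓ_v ∤ 3 M_f`, `ℓ_v ∉ S`
  have hgood := V.eventually_hasGoodReductionAt (K := ℚ)
  have h3fin : ∀ᶠ v : HeightOneSpectrum (𝓞 ℚ) in Filter.cofinite, ((3 : ℕ) : 𝓞 ℚ) ∉ v.asIdeal := by
    rw [Filter.eventually_cofinite]
    simp only [not_not]
    exact HeightOneSpectrum.finite_setOf_natCast_mem (by norm_num)
  have hSfin : ∀ᶠ v : HeightOneSpectrum (𝓞 ℚ) in Filter.cofinite, ((primesEquiv v : Nat.Primes) : ℕ) ∉ {ℓ | ℓ ∣ Mf * 3} := by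
    rw [Filter.eventually_cofinite]
    simp only [not_not]
    refine (HeightOneSpectrum.finite_setOf_natCast_mem (R := 𝓞 ℚ) (ℓ := Mf * 3)
      (mul_ne_zero (NeZero.ne Mf) (by norm_num))).subset fun v hv ↦ ?_
    rw [Set.mem_setOf_eq, CartanCarayol.natCast_mem_asIdeal_iff_natGenerator_dvd]
    exact hv
  have hS₁ : ∀ᶠ v : HeightOneSpectrum (𝓞 ℚ) in Filter.cofinite, ((primesEquiv v : Nat.Primes) : ℕ) ∉ S := by
    rw [Filter.eventually_cofinite]
    simp only [not_not]
    exact (S.finite_toSet.preimage ((Nat.Primes.coe_nat_injective.comp primesEquiv.injective).injOn)).subset fun v hv ↦ hv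
  -- § equal Frobenius polynomials at all but finitely many places
  have hev : ∀ᶠ v : HeightOneSpectrum (𝓞 ℚ) in Filter.cofinite, ∃ P : Polynomial k,
      ρf.HasFrobCharpolyAt v P ∧
        FramedGaloisRep.HasFrobCharpolyAt v P (FramedRep.baseChange j continuous_of_discreteTopology ρ) := by
    filter_upwards [hgood, h3fin, hSfin, hS₁] with v hv h3v hvS hvS₁
    obtain ⟨-, P', hP', hchar⟩ := hgalf v hvS
    have hℓMf : ¬ ((primesEquiv v : Nat.Primes) : ℕ) ∣ Mf := fun h ↦ hvS (dvd_mul_of_dvd_left h 3)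
    -- the integral Hecke polynomial `X² − a_ℓ(V) X + ℓ`, `ℓ = ℓ_v`
    have hP : (Polynomial.X ^ 2 - Polynomial.C (((V.LFunction ((primesEquiv v : Nat.Primes) : ℕ) : ℤ)) : ↥(coeffCharIntegers f)) * Polynomial.X +
          Polynomial.C ((((primesEquiv v : Nat.Primes) : ℕ)) : ↥(coeffCharIntegers f))).map
          (algebraMap ↥(coeffCharIntegers f) (coeffCharField f)) = heckePolynomial f (primesEquiv v) := by
      apply Polynomial.map_injective (algebraMap (coeffCharField f) ℂ) (algebraMap (coeffCharField f) ℂ).injective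
      rw [Polynomial.map_map, map_heckePolynomial]
      have hεp : (nebentypus f (((primesEquiv v : Nat.Primes) : ℕ) : ZMod Mf) : ℂ) * (((primesEquiv v : Nat.Primes) : ℕ) : ℂ) ^ ((2 : ℤ) - 1) =
          ((primesEquiv v : Nat.Primes) : ℕ) := by
        rw [hε, MulChar.one_apply ((ZMod.isUnit_prime_iff_not_dvd (primesEquiv v).2).mpr hℓMf)]
        norm_num
      have hαC' : ((algebraMap (coeffCharField f) ℂ).comp (algebraMap ↥(coeffCharIntegers f) (coeffCharField f)))
          (((V.LFunction ((primesEquiv v : Nat.Primes) : ℕ) : ℤ)) : ↥(coeffCharIntegers f)) = (qExpansion 1 ⇑f).coeff ((primesEquiv v : Nat.Primes) : ℕ) := by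
        rw [map_intCast, hcoef _ (primesEquiv v).2 hvS₁]
      rw [hεp, Polynomial.map_add, Polynomial.map_sub, Polynomial.map_mul, Polynomial.map_pow, Polynomial.map_X, Polynomial.map_C,
        Polynomial.map_C, map_natCast, hαC']
    have hPP' := Polynomial.map_injective _ (NumberField.RingOfIntegers.coe_injective) (hP'.trans hP.symm)
    refine ⟨P'.map ιf, hchar, ?_⟩
    have h := CartanCarayol.hasFrobCharpolyAt_baseChange_of_isTorsionGaloisRep hρ k j hv h3v
    rw [natCard_residueField_adicCompletionIntegers v, ← V.lFunction_primesEquiv_eq_frobeniusTraceAt hv, map_intCast, map_natCast] at h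
    rw [hPP']
    simpa only [Polynomial.map_add, Polynomial.map_sub, Polynomial.map_mul, Polynomial.map_pow, Polynomial.map_X, Polynomial.map_C,
      map_natCast, map_intCast, Polynomial.map_intCast, Polynomial.map_natCast] using h
  -- § Brauer–Nesbitt–Čebotarev: `ρ̄_{f,λ} ≅ ρ̄_{V,3} ⊗ k`, so the latter is carried by `f` — unramified at the place over `q`
  obtain ⟨e⟩ := FramedGaloisRep.nonempty_equiv_of_hasFrobCharpolyAt_eventually_of_discrete' ρf
    (FramedRep.baseChange j continuous_of_discreteTopology ρ) hssf hssV hev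
  have hgal := hgalf.of_equiv e
  -- § contradiction with additive reduction at `q ∈ C`
  have hv := CartanCarayol.natCast_mem_asIdeal_primesEquiv_symm hqp
  have hadd := CartanCarayol.hasAdditiveReductionAt_of_mem_cartanPlaces V hq hN hDMC _ hv
  exact hρ.not_isUnramifiedAt_baseChange_of_hasAdditiveReductionAt hadd le_rfl (CartanCarayol.three_not_mem_of_natCast_mem hqp hq3 hv) j
    continuous_of_discreteTopology (hgal _ (CartanCarayol.primesEquiv_not_mem_dvd_mul_three hqp hq3 hqMf hv)).1

/-- **No newform of level prime to the Cartan place `q` has `a_ℓ(f) = a_ℓ(V)` at almost all primes** (`f` a newform on `Γ₁(M_f)` with trivial character,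
`q ∤ M_f`, `V` with `ρ̄_{V,3}` surjective and conductor `D·M·∏_C p²`, `q ∈ C`): take a maximal ideal `𝔐 ∋ 3` of `𝓞_f` (`exists_maximal_ideal_over_ker`, with `R = ℤ`),
`k = 𝓞_f ∕ 𝔐` (discrete, characteristic `3`), `j : 𝔽₃ → k`, `ι_f = (mod 𝔐)`, and apply the residual form. [cite: DeligneSerre1974, Thm. 6.1] [cite: Serre1987, §1.2] -/
theorem false_of_newform_coeff_eq_lFunction (h61 : DeligneSerre1974.thm61_exists_adicGaloisRep)
    {V : WeierstrassCurve ℚ} [V.IsElliptic] (hS : Surj V 3)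
    {N D M : ℕ} {C : Finset ℕ} {q : ℕ} [Fact q.Prime]
    (hq : q ∈ C) (hN : V.conductorNorm ℤ = N) (hDMC : D * M * ∏ p ∈ C, p ^ 2 = N) (hq3 : q ≠ 3)
    {Mf : ℕ} [NeZero Mf] {f : CuspForm (Gamma1 Mf) 2} (hf : IsNewform1 f) (hε : nebentypus f = 1) (hqMf : ¬ q ∣ Mf)
    (S : Finset ℕ) (hcoef : ∀ ℓ : ℕ, ℓ.Prime → ℓ ∉ S → (qExpansion 1 ⇑f).coeff ℓ = ((V.LFunction ℓ : ℤ) : ℂ)) : False := by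
  classical
  haveI : NumberField (coeffCharField f) := Literature.NumberTheory.EllipticCurves.GreenbergSelmer.numberField_coeffCharField_of_isNewform1 hf
  -- § a maximal ideal `𝔐 ∋ 3` of `𝓞_f` and its residue field (characteristic `3`, discrete)
  obtain ⟨-, 𝔐, h𝔐, -, h3𝔐, -⟩ := Literature.NumberTheory.ModularSymbols.exists_maximal_ideal_over_ker (R := ℤ) (coeffCharField f) (Int.castRingHom ℂ)
    (RingHom.injective_int _) (fun r ↦ by simp) Nat.prime_three (Int.castRingHom _)
  haveI : 𝔐.IsMaximal := h𝔐
  letI kF : Field (↥(coeffCharIntegers f) ⧸ 𝔐) := Ideal.Quotient.field 𝔐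
  letI kT : TopologicalSpace (↥(coeffCharIntegers f) ⧸ 𝔐) := ⊥
  haveI : DiscreteTopology (↥(coeffCharIntegers f) ⧸ 𝔐) := ⟨rfl⟩
  have h3k : ((3 : ℕ) : ↥(coeffCharIntegers f) ⧸ 𝔐) = 0 := by
    rw [← map_natCast (Ideal.Quotient.mk 𝔐), Ideal.Quotient.eq_zero_iff_mem]
    exact h3𝔐
  haveI : CharP (↥(coeffCharIntegers f) ⧸ 𝔐) 3 := (CharP.charP_iff_prime_eq_zero Nat.prime_three).mpr h3k
  exact false_of_newform_coeff_eq_lFunction_residual h61 hS hq hN hDMC hq3 hf hε hqMf S hcoef (↥(coeffCharIntegers f) ⧸ 𝔐)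
    (ZMod.castHom (dvd_refl 3) _) (Ideal.Quotient.mk 𝔐)

end Galois

/-! #### §K.2 HECKE COMPATIBILITY on cover-invariant forms: `T_ℓ^{O_s} F = Σ_i F ∣ α_i = T_ℓ^{O₀'} F` (the representatives `α_i` of §I serve both orders) -/

omit [Fact q.Prime] in
/-- the representatives `α_i ∈ ι(O(ℓ))` lie in `ι(O₀'(ℓ))` (`O ≤ O₀'`, `nrd α_i = ℓ`). -/
theorem α_mem_unitsHeckeSet_cover {ℓ : ℕ} (S : SimRep X q ℓ) (i : Quotient (X.heckeSetoid ℓ)) :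
    S.α i ∈ unitsHeckeSet X.ι (O := coverOrder X q) ℓ := by
  obtain ⟨x, hx, hxα⟩ := S.exists_mem_O i
  exact ⟨⟨x, le_coverOrder X q hx, hxα⟩, S.det_α i⟩

/-- the comparison map `Γ∖ι(O(ℓ)) → ι(O₀'¹)∖ι(O₀'(ℓ))`, `i ↦ [α_i]`. -/
def toCoverQuot {ℓ : ℕ} (S : SimRep X q ℓ) (i : Quotient (X.heckeSetoid ℓ)) :
    Quotient (unitsHeckeSetoid X.ι (isOrder_coverOrder X q) ℓ) :=
  Quotient.mk _ ⟨S.α i, α_mem_unitsHeckeSet_cover S i⟩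

omit [Fact q.Prime] in
/-- `i ↦ [α_i]` is a bijection onto `ι(O₀'¹)∖ι(O₀'(ℓ))` ((K2) `disj` and (K3) `cover` of the simultaneous representatives). -/
theorem toCoverQuot_bijective {ℓ : ℕ} (S : SimRep X q ℓ) : Function.Bijective (toCoverQuot S) := by
  constructor
  · intro i i' h
    unfold toCoverQuot at h
    obtain ⟨u, hu, e⟩ := Quotient.exact h
    exact (S.disj' i' i u hu e.symm).symm
  · intro cq
    obtain ⟨i, u, hu, e⟩ := S.cover ((cq.out : unitsHeckeSet X.ι (O := coverOrder X q) ℓ) : GL (Fin 2) ℝ) cq.out.2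
    refine ⟨i, ?_⟩
    rw [← Quotient.out_eq cq]
    unfold toCoverQuot
    have hr : (unitsHeckeSetoid X.ι (isOrder_coverOrder X q) ℓ).r cq.out ⟨S.α i, α_mem_unitsHeckeSet_cover S i⟩ := ⟨u, hu, e⟩
    exact (Quotient.sound hr).symm

omit [Fact q.Prime] in
/-- **`T_ℓ^{O₀'}` on an `ι(O₀'¹)`-invariant function is `Σ_i h ∣ α_i`.** -/
theorem unitsHeckeFun_cover_eq_sum {ℓ : ℕ} (S : SimRep X q ℓ) [Fintype (Quotient (X.heckeSetoid ℓ))] (h : ℍ → ℂ)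
    (hinv : ∀ u ∈ coverUnits X q, h ∣[(2 : ℤ)] u = h) :
    unitsHeckeFun X.ι (isOrder_coverOrder X q) ℓ h = fun τ => ∑ i : Quotient (X.heckeSetoid ℓ), (h ∣[(2 : ℤ)] S.α i) τ := by
  haveI : Finite (Quotient (unitsHeckeSetoid X.ι (isOrder_coverOrder X q) ℓ)) := Finite.of_surjective _ (toCoverQuot_bijective S).2
  letI : Fintype (Quotient (unitsHeckeSetoid X.ι (isOrder_coverOrder X q) ℓ)) := Fintype.ofFinite _
  funext τ
  symm
  show ∑ i : Quotient (X.heckeSetoid ℓ), (h ∣[(2 : ℤ)] S.α i) τ = unitsHeckeFun X.ι (isOrder_coverOrder X q) ℓ h τ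
  rw [unitsHeckeFun_apply, finsum_eq_sum_of_fintype]
  apply Fintype.sum_bijective _ (toCoverQuot_bijective S)
  intro i
  obtain ⟨u, hu, e⟩ := Quotient.mk_out (s := unitsHeckeSetoid X.ι (isOrder_coverOrder X q) ℓ)
    (⟨S.α i, α_mem_unitsHeckeSet_cover S i⟩ : unitsHeckeSet X.ι (O := coverOrder X q) ℓ)
  dsimp only at e
  show (h ∣[(2 : ℤ)] S.α i) τ =
    (h ∣[(2 : ℤ)] (((Quotient.mk (unitsHeckeSetoid X.ι (isOrder_coverOrder X q) ℓ) ⟨S.α i, α_mem_unitsHeckeSet_cover S i⟩).out :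
      unitsHeckeSet X.ι (O := coverOrder X q) ℓ) : GL (Fin 2) ℝ)) τ
  conv_lhs => rw [← e, SlashAction.slash_mul, hinv u hu]

/-- **`T_ℓ^{O_s}` on an `ι(O₀'¹)`-invariant form of split-Cartan level is `Σ_i F ∣ α_i`** (§I.3 `heckeFn_dockTorus_split_one`: it is `Σ_i F ∣ δ_i`,
`δ_i = wit_i⁻¹ α_i` with `wit_i ∈ ι(O₀'¹)`; invariance removes `wit_i⁻¹`). -/
theorem unitsHeckeFun_Os_eq_sum (R : CoverReduction X q) (hq : q ∈ C) (Os : Submodule ℤ X.B) (hOs : Brandt.IsOrder X.B Os)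
    (hpres : ∀ m : Matrix (Fin 2) (Fin 2) ℝ, (∃ x ∈ Os, X.ι x = m) ↔
      ∃ y : coverSubring X q, (R.red y) 0 1 = 0 ∧ (R.red y) 1 0 = 0 ∧ X.ι (y : X.B) = m)
    {ℓ : ℕ} (S : SimRep X q ℓ) [Fintype (Quotient (X.heckeSetoid ℓ))]
    (F : CuspForm (R.levelOf (torusSubgroup (splitGen q))) 2) (hinv : ∀ u ∈ coverUnits X q, ⇑F ∣[(2 : ℤ)] u = ⇑F) :
    unitsHeckeFun X.ι hOs ℓ ⇑F = fun τ => ∑ i : Quotient (X.heckeSetoid ℓ), (⇑F ∣[(2 : ℤ)] S.α i) τ := by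
  rw [← S.heckeFn_dockTorus_split_one R hq Os hOs hpres F, SimRep.heckeFn_def]
  have hterm : ∀ i : Quotient (X.heckeSetoid ℓ),
      ⇑((R.dockTorus (torusSubgroup (splitGen q)) F).1 (S.c R i * 1)) ∣[(2 : ℤ)] (S.α i) = ⇑F ∣[(2 : ℤ)] (S.α i) := by
    intro i
    have hw : (R.redHom (S.wit R hq i))⁻¹ * (S.c R i * 1) ∈ torusSubgroup (splitGen q) := by
      rw [mul_one]; exact S.wit_spec R hq i
    rw [R.dockTorus_apply_of_witness _ _ hw, coverRep_apply, coe_coverSlash, CoverReduction.coe_restrictLevel,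
      hinv _ ((coverUnits X q).inv_mem (S.wit R hq i).2)]
  simp_rw [hterm]
  funext τ
  rw [Finset.sum_apply]

/-- **HECKE COMPATIBILITY.** On an `ι(O₀'¹)`-invariant form of split-Cartan level the Hecke operators of `O₀'` and of `O_s` agree at every good prime. -/
theorem unitsHeckeFun_cover_eq_Os (R : CoverReduction X q) (hq : q ∈ C) (Os : Submodule ℤ X.B) (hOs : Brandt.IsOrder X.B Os)
    (hpres : ∀ m : Matrix (Fin 2) (Fin 2) ℝ, (∃ x ∈ Os, X.ι x = m) ↔
      ∃ y : coverSubring X q, (R.red y) 0 1 = 0 ∧ (R.red y) 1 0 = 0 ∧ X.ι (y : X.B) = m)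
    {ℓ : ℕ} (hℓ : ℓ.Prime) (hgood : ¬ ℓ ∣ q * (D * M * ∏ p ∈ C, p))
    (F : CuspForm (R.levelOf (torusSubgroup (splitGen q))) 2) (hinv : ∀ u ∈ coverUnits X q, ⇑F ∣[(2 : ℤ)] u = ⇑F) :
    unitsHeckeFun X.ι (isOrder_coverOrder X q) ℓ ⇑F = unitsHeckeFun X.ι hOs ℓ ⇑F := by
  obtain ⟨S⟩ := nonempty_simRep (X := X) hq hℓ hgood
  letI := fintypeQuot X hℓ (good_of_good hgood)
  rw [unitsHeckeFun_cover_eq_sum S ⇑F hinv, unitsHeckeFun_Os_eq_sum R hq Os hOs hpres S F hinv]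

/-! #### §K.3 The invariant form as a cusp form on the cover group `ι(O₀'¹)` -/

/-- a form on `Γ̄(q)` fixed by `ρ(γ)` for every `γ ∈ ι(O₀'¹)` IS a cusp form of level `ι(O₀'¹)` (cusps transfer along the finite-index inclusion `Γ̄(q) ≤ ι(O₀'¹)`). -/
def coverForm (F₀ : CuspForm (principalLevel X q) 2) (hF₀ : ∀ γ : coverUnits X q, coverRep X q γ F₀ = F₀) : CuspForm (coverUnits X q) 2 where
  toFun := F₀
  slash_action_eq' A hA := by
    have h := congrArg (fun G : CuspForm (principalLevel X q) 2 => (⇑G : ℍ → ℂ)) (hF₀ (⟨A, hA⟩⁻¹))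
    simpa [coverRep_apply, coe_coverSlash] using h
  holo' := F₀.holo'
  zero_at_cusps' hc := F₀.zero_at_cusps'
    ((isCusp_iff_of_relIndex_ne_zero (principalLevel_le_coverUnits X q)
      (PrintClauses.finiteIndex_principalLevel_subgroupOf X q (Fact.out : q.Prime).ne_zero).index_ne_zero _).mpr hc)

@[simp] theorem coe_coverForm (F₀ : CuspForm (principalLevel X q) 2) (hF₀ : ∀ γ : coverUnits X q, coverRep X q γ F₀ = F₀) :
    ⇑(coverForm F₀ hF₀) = ⇑F₀ := rfl

/-! #### §K.4 (LL) PROVED from (DS) ∧ (JLᶜ) -/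

/-- **(LL) `NoCoverInvariantEigenform` from (JLᶜ) ∧ (DS).** A good-Hecke `a_ℓ(V)`-eigenform `F` of split-Cartan level (`T_ℓ^{O_s}`) whose restriction to `Γ̄(q)` is
`ι(O₀'¹)`-invariant is a cusp form on `ι(O₀'¹)` (§K.3) and a `T_ℓ^{O₀'}`-eigenform with the same eigenvalues (§K.2); if `F ≠ 0`, (JLᶜ) gives a newform `f ∈ S₂(Γ₁(M_f))`,
`ε_f = 1`, `M_f ∣ D·M·∏_{C∖q} p²` (so `q ∤ M_f`), `a_ℓ(f) = a_ℓ(V)` at almost all `ℓ` — impossible by §K.1. -/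
theorem noCoverInvariantEigenform_of_facts (h61 : DeligneSerre1974.thm61_exists_adicGaloisRep) (hJL : jacquetLanglands_cartanCover_newform) :
    NoCoverInvariantEigenform := by
  intro V _ _ hS N D M C q _ X hq R hN hDMC hq3 _hq3N _hc Os hOs hpres F hE hfix
  classical
  by_contra hF0
  have hqp : q.Prime := Fact.out
  -- invariance of `⇑F` under the cover group
  have hinv : ∀ u ∈ coverUnits X q, ⇑F ∣[(2 : ℤ)] u = ⇑F := by
    intro u hu
    have h := congrArg (fun G : CuspForm (principalLevel X q) 2 => (⇑G : ℍ → ℂ)) (hfix (⟨u, hu⟩⁻¹))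
    simpa [coverRep_apply, coe_coverSlash, CoverReduction.coe_restrictLevel] using h
  -- the form on the cover group
  set F' : CuspForm (coverUnits X q) 2 := coverForm (R.restrictLevel (torusSubgroup (splitGen q)) F) hfix with hF'def
  have hF'coe : (⇑F' : ℍ → ℂ) = ⇑F := rfl
  have hF'0 : (⇑F' : ℍ → ℂ) ≠ 0 := by
    rw [hF'coe]
    intro h0
    exact hF0 (DFunLike.ext' h0)
  -- good-Hecke eigenform on the cover
  have hN0 : q * (D * M * ∏ p ∈ C, p) ≠ 0 := by
    have hDM : D * M ≠ 0 := fun h ↦ (X.coprime q hq).2 (h ▸ dvd_zero q)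
    exact mul_ne_zero hqp.ne_zero (mul_ne_zero hDM (Finset.prod_ne_zero_iff.mpr fun p hp ↦ (X.coprime p hp).1.ne_zero))
  set S₁ : Finset ℕ := (q * (D * M * ∏ p ∈ C, p)).primeFactors with hS₁
  have hgoodS : ∀ ℓ : ℕ, ℓ.Prime → ℓ ∉ S₁ → ¬ ℓ ∣ q * (D * M * ∏ p ∈ C, p) := fun ℓ hℓ hℓS h ↦
    hℓS (Nat.mem_primeFactors.mpr ⟨hℓ, h, hN0⟩)
  have heig : ∀ ℓ : ℕ, ℓ.Prime → ℓ ∉ S₁ →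
      unitsHeckeFun X.ι (isOrder_coverOrder X q) ℓ ⇑F' = fun τ => ((V.LFunction ℓ : ℤ) : ℂ) * F' τ := by
    intro ℓ hℓ hℓS
    rw [hF'coe, unitsHeckeFun_cover_eq_Os R hq Os hOs hpres hℓ (hgoodS ℓ hℓ hℓS) F hinv]
    exact hE ℓ hℓ (hgoodS ℓ hℓ hℓS)
  obtain ⟨Mf, hMf, f, hdvd, hnew, hε, hcoef⟩ :=
    hJL.exists_newform1 D M C X q hq (isOrder_coverOrder X q) F' (fun ℓ ↦ ((V.LFunction ℓ : ℤ) : ℂ)) S₁ hF'0 heig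
  haveI : NeZero Mf := hMf
  exact false_of_newform_coeff_eq_lFunction h61 hS hq hN hDMC hq3 hnew hε (CartanCarayol.not_dvd_of_dvd_coverLevel X hq hdvd) S₁
    (fun ℓ hℓ hℓS ↦ hcoef ℓ hℓ hℓS (hgoodS ℓ hℓ hℓS))

/-! ### §J.5 PROVED: THE CUT — (PSV) ∧ (MO1) ⟹ (BCV) and (LL) ∧ (CV♭) ∧ (MO1) ⟹ (VAN) -/

/-- **(PSV) ∧ (MO1) ⟹ (BCV)** (real proof): `W_C` is an `a_ℓ(V)`-eigenmodule ((HF♭)); (SPH) gives a `T_s`-fixed `w ≠ 0` in `W_C`, `w = dockTorus T_s F_w`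
(`exists_eigenform_of_fixed`); (MO1): `F_w = c • F`; so `ℂ[G]·v ⊓ W_C ∋ c⁻¹ • w ≠ 0` and (BGEN) puts `v ∈ W_C`. -/
theorem borelCubicEigenDocking_of_typecut (hPSV : CubicPrincipalSeriesVector) (hMO : SplitLevelMultiplicityOne) :
    BorelCubicEigenDocking := by
  intro V _ _ hS N D M C q _ X W₁ _ Q hq R hN hDMC hq3 hq3N hc hQ h1
  have hLV : V.LFunction = W₁.LFunction := LFunction_eq_of_isIsogenous_holds V W₁ hQ.1
  have hQe : ∀ ℓ : ℕ, ℓ.Prime → ¬ ℓ ∣ D * M * ∏ p ∈ C, p →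
      X.heckeFun ℓ Q.form = fun τ => ((V.LFunction ℓ : ℤ) : ℂ) * Q.form τ := by
    intro ℓ hℓ hnd
    rw [hLV]
    exact Q.hecke_eq ℓ hℓ hnd
  have hgood : ∀ ℓ : ℕ, ¬ ℓ ∣ q * (D * M * ∏ p ∈ C, p) → ¬ ℓ ∣ D * M * ∏ p ∈ C, p :=
    fun ℓ h h' => h (dvd_mul_of_dvd_right h' q)
  obtain ⟨Os, hOs, hpres⟩ := exists_splitOrder R
  obtain ⟨𝒯, hcomm, hii, hiii⟩ := coverHeckeFamilyFn_holds D M C X q hq R Os hOs hpres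
  have hWC : ∀ ℓ : ℕ, ℓ.Prime → ¬ ℓ ∣ q * (D * M * ∏ p ∈ C, p) →
      ∀ w ∈ R.spanG (R.dockNonsplit hq Q.form), 𝒯 ℓ w = ((V.LFunction ℓ : ℤ) : ℂ) • coeLin R w :=
    fun ℓ hℓ hnd => eigenFn_of_mem_spanG R (𝒯 ℓ) (hcomm ℓ) (hii ℓ hℓ hnd Q.form _ (hQe ℓ hℓ (hgood ℓ hnd)))
  -- the (PSV) datum
  obtain ⟨lam, v, F, hv0, hlam, hvb, hF0, hFE, hdock⟩ :=
    hPSV V hS N D M C q X hq R hN hDMC hq3 hq3N hc h1 Os hOs hpres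
  -- a non-zero `T_s`-fixed vector of `W_C` and its eigenform
  have huC0 : R.dockNonsplit hq Q.form ≠ 0 := dockNonsplit_form_ne_zero Q hq R
  have huCT : ∀ t ∈ CartanTorusCubeCut.torusSubgroup R.η, R.indRep t (R.dockNonsplit hq Q.form) = R.dockNonsplit hq Q.form :=
    fun t ht => R.indRep_dockNonsplit_of_mem_torus hq Q.form ht
  obtain ⟨w, hwC, hw0, hwT⟩ := exists_splitFixed_in_spanG sphericalTransfer R huC0 huCT
  obtain ⟨Fw, hwd, hFwE⟩ := exists_eigenform_of_fixed hq R Os hOs 𝒯 hiii _ hWC hwC hwT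
  -- (MO1): `F_w = c • F`
  obtain ⟨c, hcF⟩ := hMO V N D M C q X hq R hN hDMC Os hOs hpres F Fw hFE hFwE hF0
  have hwc : w = c • R.dockTorus (CartanTorusCubeCut.torusSubgroup (splitGen q)) F := by
    rw [hwd]; exact dockTorus_eq_smul_of_coe R _ hcF
  have hc0 : c ≠ 0 := by
    rintro rfl
    exact hw0 (by rw [hwc, zero_smul])
  have hu'C : R.dockTorus (CartanTorusCubeCut.torusSubgroup (splitGen q)) F ∈ R.spanG (R.dockNonsplit hq Q.form) := by
    have h' : R.dockTorus (CartanTorusCubeCut.torusSubgroup (splitGen q)) F = c⁻¹ • w := by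
      rw [hwc, smul_smul, inv_mul_cancel₀ hc0, one_smul]
    rw [h']
    exact Submodule.smul_mem _ _ hwC
  have hu'0 : R.dockTorus (CartanTorusCubeCut.torusSubgroup (splitGen q)) F ≠ 0 := by
    intro h
    exact hw0 (by rw [hwc, h, smul_zero])
  -- (BGEN)
  exact ⟨lam, v, mem_of_borelLine_meets R hlam hvb (fun g F' hF' => R.indRep_mem_spanG _ g hF') hdock hu'C hu'0, hv0, hlam, hvb⟩

/-- **(LL) ∧ (CV♭) ∧ (MO1) ⟹ (VAN)** (real proof): (VAN)₁ — `u_C` `G`-invariant ⟹ `T_s`-fixed ⟹ docking of an `O₀'¹`-invariant `a_ℓ(V)`-eigenform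
(`apply_redHom`) ⟹ zero by (LL), contradicting `dockNonsplit_form_ne_zero`; (VAN)₂ — (MO1) ⟹ (L1S) ⟹ `W_C` irreducible, so a non-zero cubic `T_η`-eigen `F ∈ W_C`
has `ℂ[G]·F = W_C ∋ dockTorus T_s F_w` (`exists_eigenform_of_fixed`), and (CV♭) gives `F = 0`. -/
theorem nonsplitTorusCubicVanishing_of_typecut (hLL : NoCoverInvariantEigenform) (hCV : NonsplitCubicVanishingFree)
    (hMO : SplitLevelMultiplicityOne) : NonsplitTorusCubicVanishing := by
  intro V _ _ hS N D M C q _ X W₁ _ Q hq R hN hDMC hq3 hq3N hc hQ h2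
  have hLV : V.LFunction = W₁.LFunction := LFunction_eq_of_isIsogenous_holds V W₁ hQ.1
  have hQe : ∀ ℓ : ℕ, ℓ.Prime → ¬ ℓ ∣ D * M * ∏ p ∈ C, p →
      X.heckeFun ℓ Q.form = fun τ => ((V.LFunction ℓ : ℤ) : ℂ) * Q.form τ := by
    intro ℓ hℓ hnd
    rw [hLV]
    exact Q.hecke_eq ℓ hℓ hnd
  have hgood : ∀ ℓ : ℕ, ¬ ℓ ∣ q * (D * M * ∏ p ∈ C, p) → ¬ ℓ ∣ D * M * ∏ p ∈ C, p :=
    fun ℓ h h' => h (dvd_mul_of_dvd_right h' q)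
  obtain ⟨Os, hOs, hpres⟩ := exists_splitOrder R
  obtain ⟨𝒯, hcomm, hii, hiii⟩ := coverHeckeFamilyFn_holds D M C X q hq R Os hOs hpres
  have hWC : ∀ ℓ : ℕ, ℓ.Prime → ¬ ℓ ∣ q * (D * M * ∏ p ∈ C, p) →
      ∀ w ∈ R.spanG (R.dockNonsplit hq Q.form), 𝒯 ℓ w = ((V.LFunction ℓ : ℤ) : ℂ) • coeLin R w :=
    fun ℓ hℓ hnd => eigenFn_of_mem_spanG R (𝒯 ℓ) (hcomm ℓ) (hii ℓ hℓ hnd Q.form _ (hQe ℓ hℓ (hgood ℓ hnd)))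
  have huC0 : R.dockNonsplit hq Q.form ≠ 0 := dockNonsplit_form_ne_zero Q hq R
  have huCT : ∀ t ∈ CartanTorusCubeCut.torusSubgroup R.η, R.indRep t (R.dockNonsplit hq Q.form) = R.dockNonsplit hq Q.form :=
    fun t ht => R.indRep_dockNonsplit_of_mem_torus hq Q.form ht
  refine ⟨?_, ?_⟩
  · -- (VAN)₁ from (LL)
    by_contra hno
    push Not at hno
    have huT : ∀ t ∈ CartanTorusCubeCut.torusSubgroup (splitGen q), R.indRep t (R.dockNonsplit hq Q.form) = R.dockNonsplit hq Q.form :=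
      fun t _ => hno t
    obtain ⟨Fc, hcd, hFcE⟩ := exists_eigenform_of_fixed hq R Os hOs 𝒯 hiii _ hWC (R.self_mem_spanG _) huT
    have hinv : ∀ γ : coverUnits X q,
        coverRep X q γ (R.restrictLevel (CartanTorusCubeCut.torusSubgroup (splitGen q)) Fc) =
          R.restrictLevel (CartanTorusCubeCut.torusSubgroup (splitGen q)) Fc := by
      intro γ
      have e3 : (R.dockNonsplit hq Q.form).1 (R.redHom γ) = (R.dockNonsplit hq Q.form).1 1 := by
        have := congrArg (fun F : R.IndCuspForm => F.1 1) (hno (R.redHom γ))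
        simpa only [CoverReduction.indRep_apply, one_mul] using this
      rw [hcd, R.apply_redHom, R.dockTorus_apply_one] at e3
      exact e3
    have hFc : Fc = 0 := hLL V hS N D M C q X hq R hN hDMC hq3 hq3N hc Os hOs hpres Fc hFcE hinv
    apply huC0
    rw [hcd, hFc, dockTorus_zero]
  · -- (VAN)₂ from (CV♭), through the irreducibility of `W_C` ((MO1) ⟹ (L1S)(a))
    intro ν F hFC hν hFT
    by_contra hF0
    obtain ⟨hNSline, -⟩ := splitFixedRankOne_of_multiplicityOne hMO V hS N D M C q X W₁ Q hq R hN hDMC hq3 hq3N hc hQ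
    have hline0 := hNSline Q.form hQe
    have hirr := irreducible_spanG_of_rankOne sphericalTransfer R huCT fun w₁ hw₁ w₂ hw₂ =>
      hline0 w₁ (Submodule.mem_sup_left hw₁) w₂ (Submodule.mem_sup_left hw₂)
    have hle : R.spanG F ≤ R.spanG (R.dockNonsplit hq Q.form) :=
      spanG_le_of_mem R (fun g F' hF' => R.indRep_mem_spanG _ g hF') hFC
    have heq : R.spanG F = R.spanG (R.dockNonsplit hq Q.form) := by
      rcases hirr (R.spanG F) hle (fun g F' hF' => R.indRep_mem_spanG F g hF') with h | h
      · exact absurd ((Submodule.eq_bot_iff _).mp h F (R.self_mem_spanG F)) hF0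
      · exact h
    obtain ⟨w, hwC, hw0, hwT⟩ := exists_splitFixed_in_spanG sphericalTransfer R huC0 huCT
    obtain ⟨Fw, hwd, hFwE⟩ := exists_eigenform_of_fixed hq R Os hOs 𝒯 hiii _ hWC hwC hwT
    have hFw0 : Fw ≠ 0 := by
      intro h
      apply hw0
      rw [hwd, h, dockTorus_zero]
    have hwF : R.dockTorus (CartanTorusCubeCut.torusSubgroup (splitGen q)) Fw ∈ R.spanG F := by
      rw [heq, ← hwd]; exact hwC
    exact hF0 (hCV V hS N D M C q X hq R hN hDMC hq3 hq3N hc h2 Os hOs hpres ν F Fw hν hFT hFw0 hFwE hwF)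

end TypeCut

/-! ## §L NEW (generation 25, sorry-free): THE JACQUET-MODULE EXCLUSION CUT at `q ≡ 1 (3)` — `St^{T_η} = 0` in vector form, the Borel eigenvector of a Jacquet
vector, the two new leaves (JV), (NCB), and (JV) ∧ (NCB) ∧ (LL) ⟹ (BCV) WITHOUT multiplicity one -/

section Jacquet

variable {q : ℕ} [Fact q.Prime]

/-! ### §L.1 PROVED: Borel bookkeeping in `GL₂(𝔽_q)` -/

/-- the upper-triangular BOREL subgroup `B = {b : b₁₀ = 0}` of `GL₂(𝔽_q)` as a `Finset`. -/
def borelFinset (q : ℕ) [Fact q.Prime] : Finset (GL (Fin 2) (ZMod q)) :=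
  Finset.univ.filter fun b => (b : Matrix (Fin 2) (Fin 2) (ZMod q)) 1 0 = 0

theorem mem_borelFinset {b : GL (Fin 2) (ZMod q)} :
    b ∈ borelFinset q ↔ (b : Matrix (Fin 2) (Fin 2) (ZMod q)) 1 0 = 0 := by
  simp [borelFinset]

/-- `B` is closed under products. -/
theorem borel_mul {b b' : GL (Fin 2) (ZMod q)} (hb : (b : Matrix (Fin 2) (Fin 2) (ZMod q)) 1 0 = 0)
    (hb' : (b' : Matrix (Fin 2) (Fin 2) (ZMod q)) 1 0 = 0) :
    ((b * b' : GL (Fin 2) (ZMod q)) : Matrix (Fin 2) (Fin 2) (ZMod q)) 1 0 = 0 := by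
  rw [Units.val_mul, Matrix.mul_apply, Fin.sum_univ_two, hb, hb', zero_mul, mul_zero, add_zero]

/-- the `(0,0)` entry of an upper-triangular invertible matrix is non-zero. -/
theorem borel00_ne_zero {b : GL (Fin 2) (ZMod q)} (hb : (b : Matrix (Fin 2) (Fin 2) (ZMod q)) 1 0 = 0) :
    (b : Matrix (Fin 2) (Fin 2) (ZMod q)) 0 0 ≠ 0 := by
  have hdet := det_coe_ne_zero b
  rw [Matrix.det_fin_two, hb, mul_zero, sub_zero] at hdet
  exact left_ne_zero_of_mul hdet

/-- `B` is closed under inverses. -/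
theorem borel_inv {b : GL (Fin 2) (ZMod q)} (hb : (b : Matrix (Fin 2) (Fin 2) (ZMod q)) 1 0 = 0) :
    ((b⁻¹ : GL (Fin 2) (ZMod q)) : Matrix (Fin 2) (Fin 2) (ZMod q)) 1 0 = 0 := by
  have key : ((b⁻¹ * b : GL (Fin 2) (ZMod q)) : Matrix (Fin 2) (Fin 2) (ZMod q)) 1 0 = 0 := by
    rw [inv_mul_cancel, Units.val_one, Matrix.one_apply_ne (by decide)]
  rw [Units.val_mul, Matrix.mul_apply, Fin.sum_univ_two, hb, mul_zero, add_zero] at key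
  exact (mul_eq_zero.mp key).resolve_right (borel00_ne_zero hb)

/-- a matrix without rational eigenvalues has `η₁₀ ≠ 0`. -/
theorem eta10_ne_zero {eta : Matrix (Fin 2) (Fin 2) (ZMod q)} (hη : ¬ HasRatEigenvalue eta) : eta 1 0 ≠ 0 := by
  intro h
  apply hη
  refine ⟨eta 0 0, ?_⟩
  rw [Matrix.det_fin_two, Matrix.trace_fin_two, h]
  ring

/-- **`G = T_η · B`** (`T_η` is transitive on `P¹(𝔽_q)`): every `g` is `t * b` with `t` in the non-split torus of `η` and `b` upper-triangular
(a re-proof, inside this node's import cone, of the tree's `CartanTorusCubeCut.PS.exists_torus_mul_upper`). -/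
theorem exists_torus_mul_borel {eta : Matrix (Fin 2) (Fin 2) (ZMod q)} (hη : ¬ HasRatEigenvalue eta) (g : GL (Fin 2) (ZMod q)) :
    ∃ t ∈ nonsplitTorus eta, ∃ b : GL (Fin 2) (ZMod q), (b : Matrix (Fin 2) (Fin 2) (ZMod q)) 1 0 = 0 ∧ g = t * b := by
  suffices h : ∃ t ∈ nonsplitTorus eta, ((t⁻¹ * g : GL (Fin 2) (ZMod q)) : Matrix (Fin 2) (Fin 2) (ZMod q)) 1 0 = 0 by
    obtain ⟨t, ht, h10⟩ := h
    exact ⟨t, ht, t⁻¹ * g, h10, (mul_inv_cancel_left t g).symm⟩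
  by_cases hg : (g : Matrix (Fin 2) (Fin 2) (ZMod q)) 1 0 = 0
  · refine ⟨1, by simp [nonsplitTorus], ?_⟩
    rw [inv_one, one_mul]
    exact hg
  · have h10 : eta 1 0 ≠ 0 := eta10_ne_zero hη
    set s : ZMod q := (g : Matrix (Fin 2) (Fin 2) (ZMod q)) 1 0 * (eta 1 0)⁻¹ with hs
    set a : ZMod q := (g : Matrix (Fin 2) (Fin 2) (ZMod q)) 0 0 - s * eta 0 0 with ha
    have hs0 : s ≠ 0 := mul_ne_zero hg (inv_ne_zero h10)
    have hp : ((a, s) : ZMod q × ZMod q) ≠ 0 := fun h => hs0 (congrArg Prod.snd h)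
    refine ⟨linGL eta hη (a, s), ?_, ?_⟩
    · simp only [nonsplitTorus, Finset.mem_filter, Finset.mem_univ, true_and]
      rw [linGL_coe hη hp]
      exact lin_comm eta (a, s)
    · have key : (((linGL eta hη (a, s))⁻¹ * linGL eta hη (a, s) : GL (Fin 2) (ZMod q)) :
          Matrix (Fin 2) (Fin 2) (ZMod q)) 1 0 = 0 := by
        rw [inv_mul_cancel, Units.val_one, Matrix.one_apply_ne (by decide)]
      have h00' : (g : Matrix (Fin 2) (Fin 2) (ZMod q)) 0 0 =
          ((linGL eta hη (a, s) : GL (Fin 2) (ZMod q)) : Matrix (Fin 2) (Fin 2) (ZMod q)) 0 0 := by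
        rw [linGL_coe hη hp]
        simp [lin, ha]
      have h10' : (g : Matrix (Fin 2) (Fin 2) (ZMod q)) 1 0 =
          ((linGL eta hη (a, s) : GL (Fin 2) (ZMod q)) : Matrix (Fin 2) (Fin 2) (ZMod q)) 1 0 := by
        rw [linGL_coe hη hp]
        simp [lin, Matrix.one_apply_ne (by decide : (1 : Fin 2) ≠ 0), hs, inv_mul_cancel_right₀ h10]
      rw [Units.val_mul, Matrix.mul_apply, Fin.sum_univ_two] at key ⊢
      rw [h00', h10']
      exact key

/-- **`B = (diagonal torus) · N`**: an upper-triangular `b` is `t * n(y)` with `t` diagonal. -/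
theorem exists_diag_mul_unip (b : GL (Fin 2) (ZMod q)) (hb : (b : Matrix (Fin 2) (Fin 2) (ZMod q)) 1 0 = 0) :
    ∃ (t : GL (Fin 2) (ZMod q)) (y : ZMod q), (t : Matrix (Fin 2) (Fin 2) (ZMod q)) 0 1 = 0 ∧
      (t : Matrix (Fin 2) (Fin 2) (ZMod q)) 1 0 = 0 ∧ b = t * upperUnip y := by
  have h00 := borel00_ne_zero hb
  set y : ZMod q := ((b : Matrix (Fin 2) (Fin 2) (ZMod q)) 0 0)⁻¹ * (b : Matrix (Fin 2) (Fin 2) (ZMod q)) 0 1 with hy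
  refine ⟨b * upperUnip (-y), y, ?_, ?_, ?_⟩
  · have e : (b : Matrix (Fin 2) (Fin 2) (ZMod q)) 0 0 * -y + (b : Matrix (Fin 2) (Fin 2) (ZMod q)) 0 1 = 0 := by
      rw [hy, mul_neg, ← mul_assoc, mul_inv_cancel₀ h00, one_mul, neg_add_cancel]
    rw [Units.val_mul, coe_upperUnip, Matrix.mul_apply, Fin.sum_univ_two]
    simpa using e
  · rw [Units.val_mul, coe_upperUnip, Matrix.mul_apply, Fin.sum_univ_two, hb]
    simp
  · rw [mul_assoc, upperUnip_mul, neg_add_cancel, upperUnip_zero, mul_one]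

/-- a diagonal matrix with equal diagonal entries (a SCALAR) is central. -/
theorem scalar_comm {s : GL (Fin 2) (ZMod q)} (h01 : (s : Matrix (Fin 2) (Fin 2) (ZMod q)) 0 1 = 0)
    (h10 : (s : Matrix (Fin 2) (Fin 2) (ZMod q)) 1 0 = 0)
    (h00 : (s : Matrix (Fin 2) (Fin 2) (ZMod q)) 0 0 = (s : Matrix (Fin 2) (Fin 2) (ZMod q)) 1 1) (g : GL (Fin 2) (ZMod q)) :
    s * g = g * s := by
  apply Units.ext
  rw [Units.val_mul, Units.val_mul]
  ext i j
  fin_cases i <;> fin_cases j <;> simp [Matrix.mul_apply, Fin.sum_univ_two, h01, h10, h00] <;> ring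

/-- a scalar matrix lies in every torus `T_η`. -/
theorem scalar_mem_torusSubgroup (eta : Matrix (Fin 2) (Fin 2) (ZMod q)) {s : GL (Fin 2) (ZMod q)}
    (h01 : (s : Matrix (Fin 2) (Fin 2) (ZMod q)) 0 1 = 0) (h10 : (s : Matrix (Fin 2) (Fin 2) (ZMod q)) 1 0 = 0)
    (h00 : (s : Matrix (Fin 2) (Fin 2) (ZMod q)) 0 0 = (s : Matrix (Fin 2) (Fin 2) (ZMod q)) 1 1) :
    s ∈ CartanTorusCubeCut.torusSubgroup eta := by
  rw [mem_torusSubgroup]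
  ext i j
  fin_cases i <;> fin_cases j <;> simp [Matrix.mul_apply, Fin.sum_univ_two, h01, h10, h00] <;> ring

/-- `h(cⁿ) = h(c)ⁿ`. -/
theorem diagU_pow (c : (ZMod q)ˣ) (n : ℕ) : diagU (c ^ n) = diagU c ^ n := by
  induction n with
  | zero => rw [pow_zero, pow_zero, diagU_one]
  | succ n ih => rw [pow_succ, pow_succ, ← diagU_mul, ih]

/-- right translation inside a multiplicatively closed `Finset` (companion of the tree's `sum_mul_left_eq`). -/
theorem sum_mul_right_eq {Mo : Type*} [AddCommMonoid Mo] {S : Finset (GL (Fin 2) (ZMod q))}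
    (hS : ∀ u ∈ S, ∀ s ∈ S, u * s ∈ S) {u : GL (Fin 2) (ZMod q)} (hu : u ∈ S) (f : GL (Fin 2) (ZMod q) → Mo) :
    ∑ s ∈ S, f (s * u) = ∑ s ∈ S, f s := by
  have h1 : S.map ⟨(· * u), mul_left_injective u⟩ = S := by
    apply Finset.eq_of_subset_of_card_le
    · intro x hx
      rw [Finset.mem_map] at hx
      obtain ⟨s, hs, rfl⟩ := hx
      exact hS s hs u hu
    · rw [Finset.card_map]
  conv_rhs => rw [← h1]
  rw [Finset.sum_map]
  rfl

/-! ### §L.2 PROVED: `St^{T_η} = 0` in the form needed — (FIB) the fibration count of `(t, b) ↦ t b`, the `G`-INVARIANCE of the torus sum of a `B`-fixed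
vector, and the torus sums on its `G`-span -/

/-- the number of factorizations `1 = t * b` (`t ∈ T_η`, `b ∈ B`) = the size of EVERY fibre of `(t, b) ↦ t * b`. -/
def fibreCard (eta : Matrix (Fin 2) (Fin 2) (ZMod q)) : ℕ :=
  ((nonsplitTorus eta ×ˢ borelFinset q).filter fun p => p.1 * p.2 = 1).card

theorem nonsplitTorus_inv_mem {eta : Matrix (Fin 2) (Fin 2) (ZMod q)} {t : GL (Fin 2) (ZMod q)} (ht : t ∈ nonsplitTorus eta) :
    t⁻¹ ∈ nonsplitTorus eta := by
  rw [mem_nonsplitTorus_iff] at ht ⊢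
  exact Subgroup.inv_mem _ ht

/-- all fibres of `(t, b) ↦ t * b` on `T_η × B` have `fibreCard η` elements (`G = T_η B`). -/
theorem card_fibre_eq {eta : Matrix (Fin 2) (Fin 2) (ZMod q)} (hη : ¬ HasRatEigenvalue eta) (x : GL (Fin 2) (ZMod q)) :
    ((nonsplitTorus eta ×ˢ borelFinset q).filter fun p => p.1 * p.2 = x).card = fibreCard eta := by
  obtain ⟨t₀, ht₀, b₀, hb₀, hx⟩ := exists_torus_mul_borel hη x
  symm
  refine Finset.card_nbij' (fun p => (t₀ * p.1, p.2 * b₀)) (fun p => (t₀⁻¹ * p.1, p.2 * b₀⁻¹)) ?_ ?_ ?_ ?_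
  · intro p hp
    simp only [Finset.mem_coe, Finset.mem_filter, Finset.mem_product] at hp ⊢
    refine ⟨⟨nonsplitTorus_mul_mem ht₀ hp.1.1, mem_borelFinset.mpr (borel_mul (mem_borelFinset.mp hp.1.2) hb₀)⟩, ?_⟩
    rw [hx, show t₀ * p.1 * (p.2 * b₀) = t₀ * (p.1 * p.2) * b₀ by simp only [mul_assoc], hp.2, mul_one]
  · intro p hp
    simp only [Finset.mem_coe, Finset.mem_filter, Finset.mem_product] at hp ⊢
    refine ⟨⟨nonsplitTorus_mul_mem (nonsplitTorus_inv_mem ht₀) hp.1.1,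
      mem_borelFinset.mpr (borel_mul (mem_borelFinset.mp hp.1.2) (borel_inv hb₀))⟩, ?_⟩
    rw [show t₀⁻¹ * p.1 * (p.2 * b₀⁻¹) = t₀⁻¹ * (p.1 * p.2) * b₀⁻¹ by simp only [mul_assoc], hp.2, hx]
    group
  · intro p _
    simp
  · intro p _
    simp

/-- **(FIB)** `∑_{t ∈ T_η} ∑_{b ∈ B} f (g t b) = m • ∑_{x ∈ G} f x` for every `g`. -/
theorem sum_torus_borel {Mo : Type*} [AddCommMonoid Mo] {eta : Matrix (Fin 2) (Fin 2) (ZMod q)} (hη : ¬ HasRatEigenvalue eta)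
    (f : GL (Fin 2) (ZMod q) → Mo) (g : GL (Fin 2) (ZMod q)) :
    ∑ t ∈ nonsplitTorus eta, ∑ b ∈ borelFinset q, f (g * (t * b)) = fibreCard eta • ∑ x, f x := by
  have h1 : ∑ t ∈ nonsplitTorus eta, ∑ b ∈ borelFinset q, f (g * (t * b)) =
      ∑ p ∈ nonsplitTorus eta ×ˢ borelFinset q, f (g * (p.1 * p.2)) := by
    rw [← Finset.sum_product']
  have h2 : ∑ p ∈ nonsplitTorus eta ×ˢ borelFinset q, f (g * (p.1 * p.2)) =
      ∑ x ∈ (nonsplitTorus eta ×ˢ borelFinset q).image (fun p => g * (p.1 * p.2)),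
        ((nonsplitTorus eta ×ˢ borelFinset q).filter fun p => g * (p.1 * p.2) = x).card • f x := by
    rw [Finset.sum_comp]
  have himg : (nonsplitTorus eta ×ˢ borelFinset q).image (fun p => g * (p.1 * p.2)) = Finset.univ := by
    refine Finset.eq_univ_iff_forall.mpr fun x => ?_
    obtain ⟨t, ht, b, hb, e⟩ := exists_torus_mul_borel hη (g⁻¹ * x)
    refine Finset.mem_image.mpr ⟨(t, b), Finset.mem_product.mpr ⟨ht, mem_borelFinset.mpr hb⟩, ?_⟩
    show g * (t * b) = x
    rw [← e, mul_inv_cancel_left]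
  have hfil : ∀ x : GL (Fin 2) (ZMod q), ((nonsplitTorus eta ×ˢ borelFinset q).filter fun p => g * (p.1 * p.2) = x) =
      ((nonsplitTorus eta ×ˢ borelFinset q).filter fun p => p.1 * p.2 = g⁻¹ * x) := by
    intro x
    refine Finset.filter_congr fun p _ => ?_
    rw [eq_inv_mul_iff_mul_eq]
  rw [h1, h2, himg, Finset.smul_sum]
  refine Finset.sum_congr rfl fun x _ => ?_
  rw [hfil x, card_fibre_eq hη]

/-- **`St^{T_η} = 0`, concretely**: for a `B`-FIXED vector `w` of ANY complex representation of `GL₂(𝔽_q)`, the torus sum `A = ∑_{t ∈ T_η} t·w` is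
`G`-INVARIANT (`|B| • g·A = m • ∑_{x ∈ G} x·w` does not depend on `g`, by (FIB)). -/
theorem torusSum_invariant {W : Type*} [AddCommGroup W] [Module ℂ W] (ρ : Representation ℂ (GL (Fin 2) (ZMod q)) W)
    {eta : Matrix (Fin 2) (Fin 2) (ZMod q)} (hη : ¬ HasRatEigenvalue eta) {w : W}
    (hw : ∀ b : GL (Fin 2) (ZMod q), (b : Matrix (Fin 2) (Fin 2) (ZMod q)) 1 0 = 0 → ρ b w = w) (g : GL (Fin 2) (ZMod q)) :
    ρ g (∑ t ∈ nonsplitTorus eta, ρ t w) = ∑ t ∈ nonsplitTorus eta, ρ t w := by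
  have key : ∀ g : GL (Fin 2) (ZMod q),
      (borelFinset q).card • ρ g (∑ t ∈ nonsplitTorus eta, ρ t w) = fibreCard eta • ∑ x, ρ x w := by
    intro g
    have e1 : ∑ t ∈ nonsplitTorus eta, ∑ b ∈ borelFinset q, ρ (g * (t * b)) w = fibreCard eta • ∑ x, ρ x w :=
      sum_torus_borel hη (fun x => ρ x w) g
    rw [← e1, map_sum, Finset.smul_sum]
    refine Finset.sum_congr rfl fun t _ => ?_
    rw [← Finset.sum_const]
    refine Finset.sum_congr rfl fun b hb => ?_
    rw [map_mul, Module.End.mul_apply, map_mul, Module.End.mul_apply, hw b (mem_borelFinset.mp hb)]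
  have hB : (borelFinset q).card ≠ 0 :=
    Finset.card_ne_zero.mpr ⟨1, mem_borelFinset.mpr (by rw [Units.val_one, Matrix.one_apply_ne (by decide)])⟩
  have e := (key g).trans (key 1).symm
  rw [map_one, Module.End.one_apply, ← Nat.cast_smul_eq_nsmul ℂ, ← Nat.cast_smul_eq_nsmul ℂ] at e
  exact smul_right_injective W (Nat.cast_ne_zero.mpr hB) e

/-- **the torus sums of `ℂ[G]·w` are multiples of `A = ∑_{T_η} t·w`** (`w` `B`-fixed; `G = T_η B`). -/
theorem torusSum_mem_span {W : Type*} [AddCommGroup W] [Module ℂ W] (ρ : Representation ℂ (GL (Fin 2) (ZMod q)) W)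
    {eta : Matrix (Fin 2) (Fin 2) (ZMod q)} (hη : ¬ HasRatEigenvalue eta) {w : W}
    (hw : ∀ b : GL (Fin 2) (ZMod q), (b : Matrix (Fin 2) (Fin 2) (ZMod q)) 1 0 = 0 → ρ b w = w)
    {x : W} (hx : x ∈ Submodule.span ℂ (Set.range fun g : GL (Fin 2) (ZMod q) => ρ g w)) :
    ∃ c : ℂ, ∑ t ∈ nonsplitTorus eta, ρ t x = c • ∑ t ∈ nonsplitTorus eta, ρ t w := by
  induction hx using Submodule.span_induction with
  | mem x hx =>
    obtain ⟨g, rfl⟩ := hx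
    obtain ⟨t₀, ht₀, b₀, hb₀, rfl⟩ := exists_torus_mul_borel hη g
    refine ⟨1, ?_⟩
    rw [one_smul]
    have hTT : ∀ u ∈ nonsplitTorus eta, ∀ s ∈ nonsplitTorus eta, u * s ∈ nonsplitTorus eta :=
      fun u hu s hs => nonsplitTorus_mul_mem hu hs
    calc ∑ t ∈ nonsplitTorus eta, ρ t (ρ (t₀ * b₀) w)
        = ∑ t ∈ nonsplitTorus eta, ρ (t * t₀) w := by
          refine Finset.sum_congr rfl fun t _ => ?_
          rw [map_mul, Module.End.mul_apply, hw b₀ hb₀, map_mul, Module.End.mul_apply]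
      _ = ∑ t ∈ nonsplitTorus eta, ρ t w := sum_mul_right_eq hTT ht₀ fun t => ρ t w
  | zero => exact ⟨0, by simp⟩
  | add x y _ _ hx hy =>
    obtain ⟨c, hc⟩ := hx
    obtain ⟨d, hd⟩ := hy
    exact ⟨c + d, by simp only [map_add, Finset.sum_add_distrib, hc, hd, add_smul]⟩
  | smul a x _ hx =>
    obtain ⟨c, hc⟩ := hx
    exact ⟨a * c, by simp only [map_smul, ← Finset.smul_sum, hc, smul_smul]⟩

/-! ### §L.3 PROVED: (E3) the `B`-fixed exclusion and (E1)–(E2) the Borel eigenvector of a Jacquet vector, in the cover's induced module -/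

variable {D M : ℕ} {C : Finset ℕ} {X : CartanLevelCurveData D M C}

/-- **(E3) THE `B`-FIXED EXCLUSION**: inside `ℂ[G]·u` (`u` `T_η`-fixed) WITHOUT non-zero `G`-fixed vectors there is no non-zero `B`-fixed vector `w`
(`A = ∑_{T_η} t·w` is `G`-fixed, so `0`; Maschke: `u = y + z` along `ℂ[G]·w ⊕ σ'`, `y` is `T_η`-fixed in `ℂ[G]·w`, so `|T_η| • y = ∑ t·y ∈ ℂ·A = 0`, whence
`u ∈ σ'` and `w ∈ ℂ[G]·w ⊓ σ' = 0`). -/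
theorem false_of_borelFixed (R : CoverReduction X q) {u w : R.IndCuspForm}
    (huT : ∀ t ∈ CartanTorusCubeCut.torusSubgroup R.η, R.indRep t u = u) (hwu : w ∈ R.spanG u) (hw0 : w ≠ 0)
    (hwB : ∀ b : GL (Fin 2) (ZMod q), (b : Matrix (Fin 2) (Fin 2) (ZMod q)) 1 0 = 0 → R.indRep b w = w)
    (hnoG : ∀ x ∈ R.spanG u, (∀ g : GL (Fin 2) (ZMod q), R.indRep g x = x) → x = 0) : False := by
  have hwst : ∀ g : GL (Fin 2) (ZMod q), ∀ F ∈ R.spanG w, R.indRep g F ∈ R.spanG w := fun g F hF => R.indRep_mem_spanG w g hF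
  have hle : R.spanG w ≤ R.spanG u := spanG_le_of_mem R (fun g F hF => R.indRep_mem_spanG u g hF) hwu
  have hAw : ∑ t ∈ nonsplitTorus R.η, R.indRep t w ∈ R.spanG w :=
    Submodule.sum_mem _ fun t _ => hwst t w (R.self_mem_spanG w)
  have hA0 : ∑ t ∈ nonsplitTorus R.η, R.indRep t w = 0 :=
    hnoG _ (hle hAw) (torusSum_invariant R.indRep R.η_irred hwB)
  let σ : Subrepresentation R.indRep := ⟨R.spanG w, fun g F hF => hwst g F hF⟩
  obtain ⟨σ', hc⟩ := exists_isCompl σ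
  have hinf : R.spanG w ⊓ σ'.toSubmodule = ⊥ := congrArg Subrepresentation.toSubmodule hc.inf_eq_bot
  have hsup : R.spanG w ⊔ σ'.toSubmodule = ⊤ := congrArg Subrepresentation.toSubmodule hc.sup_eq_top
  have hutop : u ∈ R.spanG w ⊔ σ'.toSubmodule := by rw [hsup]; exact Submodule.mem_top
  obtain ⟨y, hy, z, hz, hsum⟩ := Submodule.mem_sup.mp hutop
  have hσ'st : ∀ g : GL (Fin 2) (ZMod q), ∀ F ∈ σ'.toSubmodule, R.indRep g F ∈ σ'.toSubmodule :=
    fun g F hF => σ'.apply_mem_toSubmodule g hF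
  have hyT : ∀ t ∈ nonsplitTorus R.η, R.indRep t y = y := by
    intro t ht
    have h := (eigen_components R hwst hσ'st hinf hy hz (t := t) (c := 1)
      (by rw [one_smul, hsum]; exact huT t (mem_nonsplitTorus_iff.mp ht))).1
    rwa [one_smul] at h
  obtain ⟨c, hc'⟩ := torusSum_mem_span R.indRep R.η_irred hwB hy
  have hTy : ∑ t ∈ nonsplitTorus R.η, R.indRep t y = ((nonsplitTorus R.η).card : ℂ) • y := by
    rw [Finset.sum_congr rfl fun t ht => hyT t ht, Finset.sum_const, Nat.cast_smul_eq_nsmul]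
  have hT : ((nonsplitTorus R.η).card : ℂ) ≠ 0 :=
    Nat.cast_ne_zero.mpr (Finset.card_ne_zero.mpr ⟨1, by simp [nonsplitTorus]⟩)
  have hy0 : y = 0 := by
    have h : ((nonsplitTorus R.η).card : ℂ) • y = 0 := by rw [← hTy, hc', hA0, smul_zero]
    exact (smul_eq_zero.mp h).resolve_left hT
  have huz : u ∈ σ'.toSubmodule := by rw [← hsum, hy0, zero_add]; exact hz
  have hle' : R.spanG u ≤ σ'.toSubmodule := spanG_le_of_mem R hσ'st huz
  have hmem : w ∈ R.spanG w ⊓ σ'.toSubmodule := ⟨R.self_mem_spanG w, hle' hwu⟩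
  rw [hinf, Submodule.mem_bot] at hmem
  exact hw0 hmem

/-- a central element fixing `u` fixes `ℂ[G]·u` pointwise. -/
theorem indRep_eq_self_of_comm (R : CoverReduction X q) {s : GL (Fin 2) (ZMod q)} (hs : ∀ g : GL (Fin 2) (ZMod q), s * g = g * s)
    {u : R.IndCuspForm} (hsu : R.indRep s u = u) {x : R.IndCuspForm} (hx : x ∈ R.spanG u) : R.indRep s x = x := by
  have hle : R.spanG u ≤ LinearMap.eqLocus (R.indRep s) LinearMap.id := by
    refine Submodule.span_le.mpr ?_
    rintro _ ⟨g, rfl⟩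
    simp only [SetLike.mem_coe, LinearMap.mem_eqLocus, LinearMap.id_apply]
    rw [← Module.End.mul_apply, ← map_mul, hs g, map_mul, Module.End.mul_apply, hsu]
  exact hle hx

/-- **the Borel scalars of an `h(d)`-eigenvector** (`d` a generator of `𝔽_q^×`): if `w ∈ ℂ[G]·u` (`u` `T_η`-fixed) is `N`-fixed and `h(d)·w = μ w`, then every
upper-triangular `b = h(c) · s · n(y)` (`s` scalar, `c = dⁿ`) acts on `w` by the scalar `μⁿ`. -/
theorem exists_borel_scalar (R : CoverReduction X q) {u w : R.IndCuspForm}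
    (huT : ∀ t ∈ CartanTorusCubeCut.torusSubgroup R.η, R.indRep t u = u) (hwu : w ∈ R.spanG u)
    (hwN : ∀ y : ZMod q, R.indRep (upperUnip y) w = w)
    {d : (ZMod q)ˣ} (hd : ∀ c : (ZMod q)ˣ, c ∈ Submonoid.powers d) {μ : ℂ} (hμ : R.indRep (diagU d) w = μ • w)
    (b : GL (Fin 2) (ZMod q)) (hb : (b : Matrix (Fin 2) (Fin 2) (ZMod q)) 1 0 = 0) :
    ∃ c : ℂ, R.indRep b w = c • w := by
  obtain ⟨t, y, ht01, ht10, rfl⟩ := exists_diag_mul_unip b hb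
  obtain ⟨c, hs01, hs10, hs00⟩ := diag_decomp t ht01 ht10
  obtain ⟨n, hn⟩ := (Submonoid.mem_powers_iff _ _).mp (hd c)
  have hsw : R.indRep ((diagU c)⁻¹ * t) w = w :=
    indRep_eq_self_of_comm R (scalar_comm hs01 hs10 hs00) (huT _ (scalar_mem_torusSubgroup R.η hs01 hs10 hs00)) hwu
  have hpow : ∀ m : ℕ, R.indRep (diagU d ^ m) w = μ ^ m • w := by
    intro m
    induction m with
    | zero => rw [pow_zero, pow_zero, map_one, Module.End.one_apply, one_smul]
    | succ m ih => rw [pow_succ, map_mul, Module.End.mul_apply, hμ, map_smul, ih, smul_smul, pow_succ, mul_comm]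
  refine ⟨μ ^ n, ?_⟩
  have ht : R.indRep t w = R.indRep (diagU c) w := by
    conv_lhs => rw [← mul_inv_cancel_left (diagU c) t]
    rw [map_mul, Module.End.mul_apply, hsw]
  rw [map_mul, Module.End.mul_apply, hwN y, ht, ← hn, diagU_pow, hpow]

/-- **(E1)+(E2) THE BOREL EIGENVECTOR OF A JACQUET VECTOR**: if `ℂ[G]·u` (`u` `T_η`-fixed) contains a non-zero `N`-fixed vector, it contains a non-zero
`N`-fixed vector `w` on which the WHOLE Borel subgroup acts by scalars `lam b` (`𝒥 = ℂ[G]·u ⊓ (N-fixed)` is finite-dimensional and stable under `h(d)`, which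
has an eigenvector there; `B = h(𝔽_q^×) · (scalars) · N`). -/
theorem exists_borelEigen_of_unipFixed (R : CoverReduction X q) {u x : R.IndCuspForm}
    (huT : ∀ t ∈ CartanTorusCubeCut.torusSubgroup R.η, R.indRep t u = u) (hxu : x ∈ R.spanG u) (hx0 : x ≠ 0)
    (hxN : ∀ y : ZMod q, R.indRep (upperUnip y) x = x) :
    ∃ w ∈ R.spanG u, w ≠ 0 ∧ (∀ y : ZMod q, R.indRep (upperUnip y) w = w) ∧
      ∃ lam : GL (Fin 2) (ZMod q) → ℂ,
        ∀ b : GL (Fin 2) (ZMod q), (b : Matrix (Fin 2) (Fin 2) (ZMod q)) 1 0 = 0 → R.indRep b w = lam b • w := by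
  obtain ⟨d, hd⟩ := IsCyclic.exists_monoid_generator (α := (ZMod q)ˣ)
  let 𝒥 : Submodule ℂ R.IndCuspForm :=
    R.spanG u ⊓ ⨅ y : ZMod q, LinearMap.eqLocus (R.indRep (upperUnip y)) LinearMap.id
  have mem𝒥 : ∀ v : R.IndCuspForm, v ∈ 𝒥 ↔ v ∈ R.spanG u ∧ ∀ y : ZMod q, R.indRep (upperUnip y) v = v := by
    intro v
    simp only [𝒥, Submodule.mem_inf, Submodule.mem_iInf, LinearMap.mem_eqLocus, LinearMap.id_apply]
  haveI : FiniteDimensional ℂ (R.spanG u) := FiniteDimensional.span_of_finite ℂ (Set.finite_range _)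
  haveI : FiniteDimensional ℂ 𝒥 := Submodule.finiteDimensional_of_le inf_le_left
  have hx𝒥 : x ∈ 𝒥 := (mem𝒥 x).mpr ⟨hxu, hxN⟩
  haveI : Nontrivial 𝒥 := ⟨⟨⟨x, hx𝒥⟩, 0, fun h => hx0 (congrArg Subtype.val h)⟩⟩
  have hstab : ∀ v ∈ 𝒥, R.indRep (diagU d) v ∈ 𝒥 := by
    intro v hv
    rw [mem𝒥] at hv ⊢
    refine ⟨R.indRep_mem_spanG u _ hv.1, fun y => ?_⟩
    have hcomm : upperUnip y * diagU d = diagU d * upperUnip (((d⁻¹ : (ZMod q)ˣ) : ZMod q) * y) := by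
      rw [diagU_mul_unip, ← mul_assoc, Units.mul_inv, one_mul]
    rw [← Module.End.mul_apply, ← map_mul, hcomm, map_mul, Module.End.mul_apply, hv.2]
  obtain ⟨μ, hμ⟩ := Module.End.exists_eigenvalue (K := ℂ) (V := 𝒥) ((R.indRep (diagU d)).restrict hstab)
  obtain ⟨v, hv⟩ := hμ.exists_hasEigenvector
  have hv𝒥 : (v : R.IndCuspForm) ∈ R.spanG u ∧ ∀ y : ZMod q, R.indRep (upperUnip y) v = v := (mem𝒥 v).mp v.2
  have hv0 : (v : R.IndCuspForm) ≠ 0 := fun h => hv.2 (Subtype.ext h)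
  have hμv : R.indRep (diagU d) (v : R.IndCuspForm) = μ • (v : R.IndCuspForm) := by
    have h := congrArg Subtype.val hv.apply_eq_smul
    simpa only [LinearMap.coe_restrict_apply, Submodule.coe_smul] using h
  have hex : ∀ b : GL (Fin 2) (ZMod q), (b : Matrix (Fin 2) (Fin 2) (ZMod q)) 1 0 = 0 →
      ∃ c : ℂ, R.indRep b v = c • (v : R.IndCuspForm) :=
    fun b hb => exists_borel_scalar R huT hv𝒥.1 hv𝒥.2 hd hμv b hb
  refine ⟨v, hv𝒥.1, hv0, hv𝒥.2,
    fun b => if h : ∃ c : ℂ, R.indRep b v = c • (v : R.IndCuspForm) then h.choose else 0, fun b hb => ?_⟩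
  beta_reduce
  rw [dif_pos (hex b hb)]
  exact (hex b hb).choose_spec

/-- the Borel scalars of a non-zero eigenvector are multiplicative on `B` (so (E2)'s `lam` satisfies the first clause of `IsCubicBorelCharacter`). -/
theorem borelChar_mul (R : CoverReduction X q) {w : R.IndCuspForm} (hw0 : w ≠ 0) {lam : GL (Fin 2) (ZMod q) → ℂ}
    (hwb : ∀ b : GL (Fin 2) (ZMod q), (b : Matrix (Fin 2) (Fin 2) (ZMod q)) 1 0 = 0 → R.indRep b w = lam b • w)
    (b b' : GL (Fin 2) (ZMod q)) (hb : (b : Matrix (Fin 2) (Fin 2) (ZMod q)) 1 0 = 0)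
    (hb' : (b' : Matrix (Fin 2) (Fin 2) (ZMod q)) 1 0 = 0) : lam (b * b') = lam b * lam b' := by
  have h := hwb (b * b') (borel_mul hb hb')
  rw [map_mul, Module.End.mul_apply, hwb b' hb', map_smul, hwb b hb, smul_smul] at h
  exact (smul_left_injective ℂ hw0 h).symm.trans (mul_comm _ _)

/-! ### §L.4 THE TWO NEW LEAVES (JV), (NCB) — `Q`-free, principal-series regime `q ≡ 1 (3)`, stated on the NON-SPLIT DOCKING of an arbitrary
`a_ℓ(V)`-eigenform `F₀` of level `X.Γ` -/

/-- **(JV) A JACQUET VECTOR at `q ≡ 1 (3)`** [NEW LEAF; local–global, principal-series regime; `Q`-FREE; UNDECIDED-in-tree; WEAKER than (BCV) at `F₀ = Q.form`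
(a cubic Borel eigenvector is `N`-fixed: `IsCubicBorelCharacter.unip`); INSTRUMENTABLE at `D = 1` (⟺ some twist `f_V ⊗ χ`, `χ mod q`, has level `N/q`: Atkin–Li)].
Under the crux's binders at `q` with `q ≡ 1 (3)`: for every `a_ℓ(V)`-eigenform `F₀` of level `X.Γ` (good `ℓ`) with non-zero non-split docking, the docked span
`ℂ[G]·dockNonsplit F₀` contains a non-zero vector fixed by the unipotent radical `N = {n(y)}` of the upper-triangular Borel subgroup. Print: `3 ∣ c_q`, `q ∤ 6`,
`q² ∥ N` ⟹ Kodaira IV ∕ IV*, tame inertia of order `3`; `q ≡ 1 (3)` ⟹ `μ₃ ⊂ ℚ_q`, the cubic inertia character extends and `π_{V,q} = PS(χ, χ')`,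
`χ|_{ℤ_q^×} = ε₃`, `χ'|_{ℤ_q^×} = ε₃⁻¹`; local–global compatibility for the indefinite quaternion algebra (Carayol) makes the `V`-part of the induced module
`Ind_B^G(ε₃ ⊠ ε₃⁻¹)`-isotypic, and the Jacquet module of `Ind_B^G(χ₁ ⊠ χ₂)` is `χ ⊕ χ^w ≠ 0` (Mackey). NO `Q`, NO `IsMinimalFor`, NO split order, NO multiplicity one.
Why it might fail: only through a mismatch between the tree's `dockNonsplit` ∕ `indRep` conventions (right translation on `Γ̄(q)`-forms) and the adelic `K(q)`-invariants,
or if `ℂ[G]·dockNonsplit F₀` could leave the `V`-part (it cannot: (HF♭) `eigenFn_of_mem_spanG` makes it an `a_ℓ(V)`-eigenmodule for all good `ℓ`).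
[cite: DokchitserDokchitser2010, §3 Case 4c p. 14] [cite: Rohrlich1993, Prop. 2] [cite: Carayol1986, Thm. (A)] [cite: Langlands1973, Thm. 7.1] [cite: Casselman1973, Thm. 1]
[cite: Bump1997, Thm. 4.1.1 p. 406, Ex. 4.1.2 p. 411] [cite: AtkinLi1978, Thm. 3.1] [cite: LoefflerWeinstein2011, Thm. 1.1] -/
def JacquetVectorFree : Prop :=
  ∀ (V : WeierstrassCurve ℚ) [V.IsElliptic] [V.IsGloballyMinimal], Surj V 3 →
    ∀ (N D M : ℕ) (C : Finset ℕ) (q : ℕ) [Fact q.Prime]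
      (X : CartanLevelCurveData D M C) (hq : q ∈ C) (R : CoverReduction X q),
      V.conductorNorm ℤ = N → D * M * ∏ p ∈ C, p ^ 2 = N → q ≠ 3 → ¬ q ^ 3 ∣ N →
      3 ∣ (V.baseChange ℚ_[q]).localTamagawaNumber ℤ_[q] → q % 3 = 1 →
      ∀ F₀ : CuspForm X.Gamma 2,
        (∀ ℓ : ℕ, ℓ.Prime → ¬ ℓ ∣ D * M * ∏ p ∈ C, p →
          X.heckeFun ℓ F₀ = fun τ => ((V.LFunction ℓ : ℤ) : ℂ) * F₀ τ) →
        R.dockNonsplit hq F₀ ≠ 0 →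
        ∃ x ∈ R.spanG (R.dockNonsplit hq F₀), x ≠ 0 ∧ ∀ y : ZMod q, R.indRep (upperUnip y) x = x

/-- **(NCB) NO NON-CUBIC BOREL TYPE at `q ≡ 1 (3)`** [NEW LEAF; local–global, principal-series regime; `Q`-FREE; UNDECIDED-in-tree; WEAKER than (ISO)♮ (the
`V`-part is `Ind_B^G(ε₃ ⊠ ε₃⁻¹)`-isotypic and the only Borel eigencharacters of `Ind_B^G(χ₁ ⊠ χ₂)`, `χ₁ ≠ χ₂`, are `χ₁ ⊠ χ₂` and `χ₂ ⊠ χ₁` — both CUBIC Borel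
characters `ε₃^{±1}(a/d)` here — Frobenius reciprocity + Mackey); INSTRUMENTABLE at `D = 1` (a twist of `f_V` of level `N/q` with non-cubic nebentypus refutes it)].
Under the crux's binders at `q` with `q ≡ 1 (3)`: a vector `v ∈ ℂ[G]·dockNonsplit F₀` (`F₀` an `a_ℓ(V)`-eigenform of level `X.Γ`) on which the Borel subgroup acts by
scalars `lam b`, with `lam` NON-trivial on some diagonal element and `lam` NOT a cubic Borel character (`IsCubicBorelCharacter`: multiplicative on `B`, trivial when
`b₀₀/b₁₁` is a cube, non-trivial on the diagonal torus — for `v ≠ 0` the first clause is automatic, `borelChar_mul`), is ZERO. The SPHERICAL Borel type (`lam` trivial on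
the diagonal torus) is deliberately excluded from the statement: it is killed unconditionally by (E3) `false_of_borelFixed` + (LL). NO `Q`, NO irreducibility, NO
multiplicity one. Why it might fail: a Borel eigenvector of `W_{F₀}` with character `ε ⊠ ε'`, `ε/ε'` of order not `3` — excluded in print exactly by the local type
`PS(ε₃·unr, ε₃⁻¹·unr)` (it would force a twist of `f_V` of level `N/q` with non-cubic nebentypus, against `3 ∣ c_q` ⟹ `e = 3`).
[cite: DokchitserDokchitser2010, §3 Case 4c p. 14] [cite: Carayol1986, Thm. (A)] [cite: Langlands1973, Thm. 7.1] [cite: Bump1997, Thm. 4.1.1 p. 406, Ex. 4.1.2 p. 411]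
[cite: BushnellHenniart2006, §14] [cite: AtkinLi1978, Thm. 3.1] [cite: LoefflerWeinstein2011, Thm. 1.1] -/
def NonCubicBorelVanishingFree : Prop :=
  ∀ (V : WeierstrassCurve ℚ) [V.IsElliptic] [V.IsGloballyMinimal], Surj V 3 →
    ∀ (N D M : ℕ) (C : Finset ℕ) (q : ℕ) [Fact q.Prime]
      (X : CartanLevelCurveData D M C) (hq : q ∈ C) (R : CoverReduction X q),
      V.conductorNorm ℤ = N → D * M * ∏ p ∈ C, p ^ 2 = N → q ≠ 3 → ¬ q ^ 3 ∣ N →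
      3 ∣ (V.baseChange ℚ_[q]).localTamagawaNumber ℤ_[q] → q % 3 = 1 →
      ∀ (F₀ : CuspForm X.Gamma 2) (lam : GL (Fin 2) (ZMod q) → ℂ) (v : R.IndCuspForm),
        (∀ ℓ : ℕ, ℓ.Prime → ¬ ℓ ∣ D * M * ∏ p ∈ C, p →
          X.heckeFun ℓ F₀ = fun τ => ((V.LFunction ℓ : ℤ) : ℂ) * F₀ τ) →
        (∀ b : GL (Fin 2) (ZMod q), (b : Matrix (Fin 2) (Fin 2) (ZMod q)) 1 0 = 0 → R.indRep b v = lam b • v) →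
        ¬ IsCubicBorelCharacter q lam →
        (∃ t : GL (Fin 2) (ZMod q), (t : Matrix (Fin 2) (Fin 2) (ZMod q)) 0 1 = 0 ∧
          (t : Matrix (Fin 2) (Fin 2) (ZMod q)) 1 0 = 0 ∧ lam t ≠ 1) →
        v ∈ R.spanG (R.dockNonsplit hq F₀) → v = 0

/-! ### §L.5 PROVED: THE CUT — (JV) ∧ (NCB) ∧ (LL) ⟹ (BCV), with NO multiplicity one -/

/-- **(JV) ∧ (NCB) ∧ (LL) ⟹ (BCV)** (real proof; NO (MO1), NO (PSV)): `W_C` is an `a_ℓ(V)`-eigenmodule ((HF♭)) without non-zero `G`-fixed vectors ((LL) via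
FIX ⟹ DOCK, as in (VAN)₁); (JV) gives a Jacquet vector, (E1)+(E2) a Borel eigenvector `w ∈ W_C` with scalars `lam`; if `lam` is a cubic Borel character we are done,
if it is non-trivial on the diagonal torus and non-cubic (NCB) kills `w`, and if it is trivial on the diagonal torus `w` is `B`-fixed and (E3) kills it. -/
theorem borelCubicEigenDocking_of_jacquet (hJV : JacquetVectorFree) (hNCB : NonCubicBorelVanishingFree)
    (hLL : NoCoverInvariantEigenform) : BorelCubicEigenDocking := by
  intro V _ _ hS N D M C q _ X W₁ _ Q hq R hN hDMC hq3 hq3N hc hQ h1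
  have hLV : V.LFunction = W₁.LFunction := LFunction_eq_of_isIsogenous_holds V W₁ hQ.1
  have hQe : ∀ ℓ : ℕ, ℓ.Prime → ¬ ℓ ∣ D * M * ∏ p ∈ C, p →
      X.heckeFun ℓ Q.form = fun τ => ((V.LFunction ℓ : ℤ) : ℂ) * Q.form τ := by
    intro ℓ hℓ hnd
    rw [hLV]
    exact Q.hecke_eq ℓ hℓ hnd
  have hgood : ∀ ℓ : ℕ, ¬ ℓ ∣ q * (D * M * ∏ p ∈ C, p) → ¬ ℓ ∣ D * M * ∏ p ∈ C, p :=
    fun ℓ h h' => h (dvd_mul_of_dvd_right h' q)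
  obtain ⟨Os, hOs, hpres⟩ := exists_splitOrder R
  obtain ⟨𝒯, hcomm, hii, hiii⟩ := coverHeckeFamilyFn_holds D M C X q hq R Os hOs hpres
  have hWC : ∀ ℓ : ℕ, ℓ.Prime → ¬ ℓ ∣ q * (D * M * ∏ p ∈ C, p) →
      ∀ w ∈ R.spanG (R.dockNonsplit hq Q.form), 𝒯 ℓ w = ((V.LFunction ℓ : ℤ) : ℂ) • coeLin R w :=
    fun ℓ hℓ hnd => eigenFn_of_mem_spanG R (𝒯 ℓ) (hcomm ℓ) (hii ℓ hℓ hnd Q.form _ (hQe ℓ hℓ (hgood ℓ hnd)))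
  have huC0 : R.dockNonsplit hq Q.form ≠ 0 := dockNonsplit_form_ne_zero Q hq R
  have huCT : ∀ t ∈ CartanTorusCubeCut.torusSubgroup R.η, R.indRep t (R.dockNonsplit hq Q.form) = R.dockNonsplit hq Q.form :=
    fun t ht => R.indRep_dockNonsplit_of_mem_torus hq Q.form ht
  -- no non-zero `G`-fixed vector in `W_C` ((LL), exactly as in (VAN)₁)
  have hnoG : ∀ x ∈ R.spanG (R.dockNonsplit hq Q.form), (∀ g : GL (Fin 2) (ZMod q), R.indRep g x = x) → x = 0 := by
    intro x hxC hfix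
    have hxT : ∀ t ∈ CartanTorusCubeCut.torusSubgroup (splitGen q), R.indRep t x = x := fun t _ => hfix t
    obtain ⟨Fc, hcd, hFcE⟩ := exists_eigenform_of_fixed hq R Os hOs 𝒯 hiii _ hWC hxC hxT
    have hinv : ∀ γ : coverUnits X q,
        coverRep X q γ (R.restrictLevel (CartanTorusCubeCut.torusSubgroup (splitGen q)) Fc) =
          R.restrictLevel (CartanTorusCubeCut.torusSubgroup (splitGen q)) Fc := by
      intro γ
      have e3 : x.1 (R.redHom γ) = x.1 1 := by
        have := congrArg (fun F : R.IndCuspForm => F.1 1) (hfix (R.redHom γ))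
        simpa only [CoverReduction.indRep_apply, one_mul] using this
      rw [hcd, R.apply_redHom, R.dockTorus_apply_one] at e3
      exact e3
    have hFc : Fc = 0 := hLL V hS N D M C q X hq R hN hDMC hq3 hq3N hc Os hOs hpres Fc hFcE hinv
    rw [hcd, hFc, dockTorus_zero]
  -- (E1) a Jacquet vector of `W_C`, (E2) a Borel eigenvector `w ∈ W_C` with scalars `lam`
  obtain ⟨x, hxC, hx0, hxN⟩ := hJV V hS N D M C q X hq R hN hDMC hq3 hq3N hc h1 Q.form hQe huC0
  obtain ⟨w, hwC, hw0, hwN, lam, hwb⟩ := exists_borelEigen_of_unipFixed R huCT hxC hx0 hxN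
  by_cases hcub : IsCubicBorelCharacter q lam
  · exact ⟨lam, w, hwC, hw0, hcub, hwb⟩
  exfalso
  by_cases hnt : ∃ t : GL (Fin 2) (ZMod q), (t : Matrix (Fin 2) (Fin 2) (ZMod q)) 0 1 = 0 ∧
      (t : Matrix (Fin 2) (Fin 2) (ZMod q)) 1 0 = 0 ∧ lam t ≠ 1
  · -- (E4) a non-cubic, non-spherical Borel type inside `W_C`: excluded by (NCB)
    exact hw0 (hNCB V hS N D M C q X hq R hN hDMC hq3 hq3N hc h1 Q.form lam w hQe hwb hcub hnt hwC)
  · -- (E3) `lam` is trivial on the diagonal torus, so `w` is `B`-FIXED: excluded by `St^{T_η} = 0` and (LL)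
    push Not at hnt
    have hwB : ∀ b : GL (Fin 2) (ZMod q), (b : Matrix (Fin 2) (Fin 2) (ZMod q)) 1 0 = 0 → R.indRep b w = w := by
      intro b hb
      obtain ⟨t, y, ht01, ht10, rfl⟩ := exists_diag_mul_unip b hb
      rw [map_mul, Module.End.mul_apply, hwN y, hwb t ht10, hnt t ht01 ht10, one_smul]
    exact false_of_borelFixed R huCT hwC hw0 hwB hnoG

end Jacquet

/-! ## §N NEW (generation 27, sorry-free): THE RATIONAL-GHOST CUT at `q ≡ 1 (3)` — (JV) at `F₀ = Q.form` from (IRR)♮, integrality (RAT)♮, ONE finite-group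
lemma (RCG) «a rational cuspidal `PGL₂(𝔽_q)`-type needs `4 ∣ q + 1`», and the residual (JV₇) on `q ≡ 3 (mod 4)` only. -/

section Ghost

variable {D M : ℕ} {C : Finset ℕ} {X : CartanLevelCurveData D M C} {q : ℕ} [Fact q.Prime]

/-! ### §N.1 (RAT)♮ — generation 15's integrality leaf, VERBATIM (`Lines/weylsign.lean` e2115ac36e228efe §1 ∕ §2; also `Lines/serreweight.lean`) -/

/-- **(RAT)♮ THE CHARACTER OF THE DOCKED SPAN IS INTEGER-VALUED** [NEW; type-free]. Under the binders of NUM at the Cartan place `q`: every representation `ρ`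
of `GL₂(𝔽_q)` on `ℂ[G]·u_C` agreeing with `indRep` has `tr ρ(g) ∈ ℤ` for all `g`. In print: the period lattice `𝕃(u_C, Λ)` is a `G`-stable discrete subgroup
(Eichler–Shimura), its real span a `G`-stable real form of `ℂ[G]·u_C` once the CM branch is excluded (multiplicative prime `3` of `V`), so `tr_ℂ = tr_ℤ` — the
real-form branch of the tree's `CMRank.trace_latticeRep_eq_cubicNewvectorChar`, whose only use of the cubic trace (the line `dim W^{T_η} = 1` in the CM branch) is
replaced by the Gelfand-pair bound `dim W^{T_η} ≤ 1` for `(GL₂(𝔽_q), 𝔽_{q²}^×)`. WEAKER than (ISO)♮: PROVED (`rationalCharacter_of_iso`). ATTACKABLE in-tree.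
Why it might fail: it cannot for the `V`-part; as typed it is implied by (ISO)♮. [cite: ShimuraIATAF1971, Thm. 8.4 p. 234] [cite: Bump1997, Prop. 4.1.3] -/
def RationalCharacter : Prop :=
  ∀ (V : WeierstrassCurve ℚ) [V.IsElliptic] [V.IsGloballyMinimal], Surj V 3 →
    ∀ (N D M : ℕ) (C : Finset ℕ) (q : ℕ) [Fact q.Prime]
      (X : CartanLevelCurveData D M C) (W₁ : WeierstrassCurve ℚ) [W₁.IsElliptic] (Q : CartanParametrizationData X W₁)
      (hq : q ∈ C) (R : CoverReduction X q),
      V.conductorNorm ℤ = N → D * M * ∏ p ∈ C, p ^ 2 = N → q ≠ 3 → ¬ q ^ 3 ∣ N →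
      3 ∣ (V.baseChange ℚ_[q]).localTamagawaNumber ℤ_[q] → Q.IsMinimalFor V →
      ∀ (ρ : Representation ℂ (GL (Fin 2) (ZMod q)) (R.spanG (R.dockNonsplit hq Q.form))),
        (∀ (g : GL (Fin 2) (ZMod q)) (F : R.spanG (R.dockNonsplit hq Q.form)),
          ((ρ g F : R.spanG (R.dockNonsplit hq Q.form)) : R.IndCuspForm) = R.indRep g (F : R.IndCuspForm)) →
        ∀ g : GL (Fin 2) (ZMod q), ∃ n : ℤ, LinearMap.trace ℂ _ (ρ g) = (n : ℂ)

/-- **(RAT)♮ is WEAKER than (ISO)♮** (real proof, generation 15 verbatim): the irreducible `𝒱 ∋ u_C` of (ISO)♮ is `ℂ[G]·u_C`; two representations on it agreeing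
with `indRep` agree; `χ_{W_q}` is `ℤ`-valued. -/
theorem rationalCharacter_of_iso (hISO : CartanNatural.CoverIsotypicComponent) : RationalCharacter := by
  intro V _ _ hS N D M C q _ X W₁ _ Q hq R hN hDMC hq3 hq3N hc hQ ρ' hρ' g
  obtain ⟨𝒱, ρ, hρ, hirr, htr, hNS, -⟩ := hISO V hS N D M C q X W₁ Q hq R hN hDMC hq3 hq3N hc hQ
  have hstab : ∀ g : GL (Fin 2) (ZMod q), ∀ F ∈ 𝒱, R.indRep g F ∈ 𝒱 := fun g F hF => by
    rw [← hρ g ⟨F, hF⟩]; exact (ρ g ⟨F, hF⟩).2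
  have hVW : V.LFunction = W₁.LFunction := LFunction_eq_of_isIsogenous_holds V W₁ hQ.1
  have huC : R.dockNonsplit hq Q.form ∈ 𝒱 := hNS Q.form fun ℓ hℓ hnd => by rw [hVW]; exact Q.hecke_eq ℓ hℓ hnd
  have heq : R.spanG (R.dockNonsplit hq Q.form) = 𝒱 :=
    eq_spanG_of_irreducible_of_mem R (dockNonsplit_form_ne_zero Q hq R) hstab hirr huC
  subst heq
  refine ⟨cubicNewvectorChar q g, ?_⟩
  have hρρ : ρ' g = ρ g := by
    apply LinearMap.ext
    intro v
    apply Subtype.ext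
    rw [hρ', hρ]
  rw [hρρ, htr g]

/-! ### §N.2 The three NEW statements: (JV_Q) the docked Jacquet vector, (JV₇) its residual on `q ≡ 3 (mod 4)`, (RCG) the rational-cuspidal-ghost lemma -/

/-- **(JV_Q) A JACQUET VECTOR IN THE DOCKED SPAN `ℂ[G]·u_C` at `q ≡ 1 (3)`** [NEW as a statement; = generation 25's (JV) `JacquetVectorFree` SPECIALISED to
`F₀ = Q.form` (PROVED WEAKER: `jacquetVectorDocked_of_free`) — which is the only instance §L.5 `borelCubicEigenDocking_of_jacquet` ever consumes; DERIVED in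
§N.3 from (IRR)♮ ∧ (RAT)♮ ∧ (RCG) ∧ (JV₇) (`jacquetVectorDocked_of_ghost`); NOT a stub of this node]. Under NUM's binders at the Cartan place `q ≡ 1 (3)`:
`ℂ[G]·dockNonsplit(Q.form)` contains a non-zero vector fixed by the unipotent radical `N = {n(y)}` of the upper-triangular Borel subgroup. In print: the `V`-part
of the cover is NOT cuspidal, i.e. `π_{V,q}` is not supercuspidal (depth-zero principal series `PS(ε₃·unr, ε₃⁻¹·unr)` by `3 ∣ c_q` ⟹ `e = 3`, `3 ∣ q − 1`).
[cite: Bump1997, Thm. 4.1.1 p. 406] [cite: Langlands1973, Thm. 7.1] [cite: Carayol1986, Thm. (A)] [cite: AtkinLi1978, Thm. 3.1] [cite: DokchitserDokchitser2010, §3 Case 4c p. 14] -/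
def JacquetVectorDocked : Prop :=
  ∀ (V : WeierstrassCurve ℚ) [V.IsElliptic] [V.IsGloballyMinimal], Surj V 3 →
    ∀ (N D M : ℕ) (C : Finset ℕ) (q : ℕ) [Fact q.Prime]
      (X : CartanLevelCurveData D M C) (W₁ : WeierstrassCurve ℚ) [W₁.IsElliptic] (Q : CartanParametrizationData X W₁)
      (hq : q ∈ C) (R : CoverReduction X q),
      V.conductorNorm ℤ = N → D * M * ∏ p ∈ C, p ^ 2 = N → q ≠ 3 → ¬ q ^ 3 ∣ N →
      3 ∣ (V.baseChange ℚ_[q]).localTamagawaNumber ℤ_[q] → Q.IsMinimalFor V → q % 3 = 1 →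
      ∃ x ∈ R.spanG (R.dockNonsplit hq Q.form), x ≠ 0 ∧ ∀ y : ZMod q, R.indRep (upperUnip y) x = x

/-- **(JV₇) THE RESIDUAL JACQUET VECTOR at `q ≡ 1 (3)`, `q ≡ 3 (4)` (i.e. `q ≡ 7 (12)`)** [NEW LEAF = (JV_Q) restricted to the residue class where a RATIONAL
CUSPIDAL GHOST `π(ν₄)` exists (PROVED WEAKER than (JV_Q): `jacquetVectorResidual_of_docked`); UNDECIDED-in-tree; INSTRUMENTABLE at `D = 1` (Atkin–Li: a cubic
twist `f_V ⊗ χ₃` of level `N∕q` at `q ∈ {7, 19, 31, 43, 67, 79, …}` — kit j342858 ∕ j342924 already report `d(χ₃) = 1` at every tested pair); IDEA-NEEDED in tree].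
In print the content is «the `V`-part is not `π(ν₄)`», the depth-zero supercuspidal type of semistability defect `e = 4` (Kodaira III ∕ III*, `c_q = 2`), against
`3 ∣ c_q` ⟹ `e = 3` — local–global compatibility (Carayol (A)), or any Carayol-free detector of `e mod 4` (e.g. `v_q(Δ_min) ∈ {4, 8}` vs `{3, 9}`).
Why it might fail: only as (JV) could — a convention mismatch between `dockNonsplit` ∕ `indRep` and adelic `K(q)`-invariants; for the `V`-part it is the type.
[cite: Carayol1986, Thm. (A)] [cite: Rohrlich1993, Prop. 2] [cite: DokchitserDokchitser2010, §3 Case 4c p. 14] [cite: Bump1997, Thm. 4.1.1, Prop. 4.1.6]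
[cite: AtkinLi1978, Thm. 3.1] [cite: LoefflerWeinstein2011, Thm. 1.1] -/
def JacquetVectorResidual : Prop :=
  ∀ (V : WeierstrassCurve ℚ) [V.IsElliptic] [V.IsGloballyMinimal], Surj V 3 →
    ∀ (N D M : ℕ) (C : Finset ℕ) (q : ℕ) [Fact q.Prime]
      (X : CartanLevelCurveData D M C) (W₁ : WeierstrassCurve ℚ) [W₁.IsElliptic] (Q : CartanParametrizationData X W₁)
      (hq : q ∈ C) (R : CoverReduction X q),
      V.conductorNorm ℤ = N → D * M * ∏ p ∈ C, p ^ 2 = N → q ≠ 3 → ¬ q ^ 3 ∣ N →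
      3 ∣ (V.baseChange ℚ_[q]).localTamagawaNumber ℤ_[q] → Q.IsMinimalFor V → q % 3 = 1 → q % 4 = 3 →
      ∃ x ∈ R.spanG (R.dockNonsplit hq Q.form), x ≠ 0 ∧ ∀ y : ZMod q, R.indRep (upperUnip y) x = x

/-- **(RCG) THE RATIONAL-CUSPIDAL-GHOST LEMMA** [NEW LEAF; FINITE GROUP THEORY of `GL₂(𝔽_q)`; `V`-free, class-free, type-free; ATTACKABLE in tree]. For a prime
`q ≡ 1 (3)` and `eta` without rational eigenvalue (so `torusSubgroup eta = T_η` is a non-split Cartan subgroup, containing the centre): an IRREDUCIBLE finite-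
dimensional complex representation `W` of `GL₂(𝔽_q)` that (i) has a non-zero `T_η`-fixed vector, (ii) has INTEGER-valued character, and (iii) has NO non-zero
vector fixed by the unipotent radical `N = {n(y)}`, can exist only if `q ≡ 3 (mod 4)`. Print proof: (iii) + irreducible ⟹ `W` is cuspidal, `W ≅ π(ν)` for a regular
character `ν` of `𝔽_{q²}^×` (every non-cuspidal irreducible — `χ∘det`, `χ·St`, `PS(χ₁, χ₂)` — has `N`-fixed vectors); (i) ⟹ the trivial character of `T_η` occurs
in `π(ν)|_{T_η} = ⊕ {θ : θ|_Z = ν|_Z, θ ∉ {ν, ν^q}}`, so `ν|_{𝔽_q^×} = 1` and `ν` is a character of the cyclic group `𝔽_{q²}^× ∕ 𝔽_q^×` of order `q + 1`, of some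
order `n ≥ 3` (regularity: `ν^q = ν⁻¹ ≠ ν`); (ii) on an elliptic element with eigenvalue a generator: `−(ζ_n + ζ_n⁻¹) ∈ ℤ` ⟹ `φ(n) ≤ 2` ⟹ `n ∈ {3, 4, 6}`; `n ∣ q+1`
and `q ≡ 1 (3)` ⟹ `3 ∤ q + 1` ⟹ `n = 4` ⟹ `4 ∣ q + 1`. (At `q ≡ 7 (12)` the ghost `π(ν₄)` does satisfy (i)–(iii): the lemma is sharp.) Why it might fail: it
cannot (a theorem of the character table); as TYPED the only risk is a convention slip in `torusSubgroup` (it contains the centre — needed for (i) ⟹ `ω = 1`).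
[cite: Bump1997, §4.1 Thm. 4.1.1 p. 406, Prop. 4.1.3, Prop. 4.1.6] [cite: FultonHarris1991, §5.2] [cite: Bump1997, Prop. 4.1.5, Prop. 4.1.6 p. 407] [cite: JamesLiebeck2001, Thm. 28.5] -/
def RationalCuspidalGhost : Prop :=
  ∀ (q : ℕ) [Fact q.Prime], q % 3 = 1 →
    ∀ (eta : Matrix (Fin 2) (Fin 2) (ZMod q)), ¬ HasRatEigenvalue eta →
    ∀ (W : Type) [AddCommGroup W] [Module ℂ W] [Module.Finite ℂ W] (ρ : Representation ℂ (GL (Fin 2) (ZMod q)) W),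
      (∀ W' : Submodule ℂ W, (∀ g : GL (Fin 2) (ZMod q), ∀ w ∈ W', ρ g w ∈ W') → W' = ⊥ ∨ W' = ⊤) →
      (∃ u : W, u ≠ 0 ∧ ∀ t ∈ CartanTorusCubeCut.torusSubgroup eta, ρ t u = u) →
      (∀ g : GL (Fin 2) (ZMod q), ∃ n : ℤ, LinearMap.trace ℂ W (ρ g) = (n : ℂ)) →
      (∀ w : W, (∀ y : ZMod q, ρ (upperUnip y) w = w) → w = 0) →
      q % 4 = 3

/-- **(CTT) THE CUSPIDAL TORUS TYPE** [NEW LEAF; FINITE GROUP THEORY of `GL₂(𝔽_q)` at EVERY prime `q` (no residue-class hypothesis); `V`-free, class-free,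
type-free; ATTACKABLE in tree]. For `eta` without rational eigenvalue (`torusSubgroup eta = T_η ∋ Z`): an IRREDUCIBLE finite-dimensional complex representation
`W` of `GL₂(𝔽_q)` with (i) a non-zero `T_η`-fixed vector and (iii) NO non-zero `N`-fixed vector has, at SOME `t ∈ T_η`, trace `−(ζ + ζ⁻¹)` with `ζ` a primitive
`n`-th root of unity, `3 ≤ n`, `n ∣ q + 1`. Print proof = the cuspidal row of the character table: (iii) + irreducible ⟹ `W ≅ π(ν)` cuspidal, `ν` a REGULAR character
of `T_η ≅ 𝔽_{q²}^×`; (i) ⟹ `ν|_Z = 1` (`scalar_trivial`), so `ν` factors through the cyclic group `T_η ∕ Z` of order `q + 1` with order `n ≥ 3` (`ν ≠ ν^q = ν⁻¹`);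
at a generator `t` of `T_η`: `χ_{π(ν)}(t) = −(ν(t) + ν(t)^q) = −(ζ + ζ⁻¹)`, `ζ := ν(t)` primitive of order `n`. In-tree road (the tree's §F.6 pinning engine, made
`ν`-general): realise every `Ind_{ZN}^G ψ − Ind_{T_η}^G ν` (`ν` regular, `ν|_Z = 1`) as an irreducible (`exists_irreducible_of_virtual_normOne`), count
`dim W = (q − 1)·dim Hom_N(ψ, W)` by the Fourier projectors `four` against `W|_{T_η} = ⊕_θ Hom_{T_η}(θ, W)` to force a non-zero pairing with some regular `ν`
(`frobenius_reciprocity`, `exists_four_ne_zero`), pin `χ_W` (`char_eq_of_pairing_ne_zero`), evaluate `Ind_{T_η}^G ν` at a generator (`torusInd_elliptic`, `ν`-general).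
Degenerate cases checked: `q = 2` (`W = sgn` of `S₃`: `t` a 3-cycle, `n = 3`, `−(ω + ω²) = 1` ✓), `q = 3` (`π(ν₄)`: `n = 4`, trace `0` ✓), `W = 0` excluded by (i).
Why it might fail: it cannot (character table, [cite: JamesLiebeck2001, Thm. 28.5] row `χ_i`: `−(r̄^i + r̄^{iq})` on the elliptic class); as TYPED only a slip in
`torusSubgroup` ∕ `upperUnip` conventions. [cite: JamesLiebeck2001, Thm. 28.5] [cite: Bump1997, Prop. 4.1.5, Prop. 4.1.6 p. 407] [cite: FultonHarris1991, §5.2] -/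
def CuspidalTorusType : Prop :=
  ∀ (q : ℕ) [Fact q.Prime] (eta : Matrix (Fin 2) (Fin 2) (ZMod q)), ¬ HasRatEigenvalue eta →
    ∀ (W : Type) [AddCommGroup W] [Module ℂ W] [Module.Finite ℂ W] (ρ : Representation ℂ (GL (Fin 2) (ZMod q)) W),
      (∀ W' : Submodule ℂ W, (∀ g : GL (Fin 2) (ZMod q), ∀ w ∈ W', ρ g w ∈ W') → W' = ⊥ ∨ W' = ⊤) →
      (∃ u : W, u ≠ 0 ∧ ∀ t ∈ CartanTorusCubeCut.torusSubgroup eta, ρ t u = u) →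
      (∀ w : W, (∀ y : ZMod q, ρ (upperUnip y) w = w) → w = 0) →
      ∃ t ∈ CartanTorusCubeCut.torusSubgroup eta, ∃ (n : ℕ) (ζ : ℂ),
        3 ≤ n ∧ n ∣ q + 1 ∧ IsPrimitiveRoot ζ n ∧ LinearMap.trace ℂ W (ρ t) = -(ζ + ζ⁻¹)

/-! ### §N.3 PROVED: (JV) ⟹ (JV_Q) ⟹ (JV₇); THE GHOST CUT (IRR)♮ ∧ (RAT)♮ ∧ (RCG) ∧ (JV₇) ⟹ (JV_Q); and §L.5 re-run on (JV_Q): (JV_Q) ∧ (NCB) ∧ (LL) ⟹ (BCV) -/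

/-- **(JV_Q) is WEAKER than generation 25's (JV)** (real proof: specialise `F₀ := Q.form`, an `a_ℓ(V)`-eigenform by Faltings + `Q.hecke_eq`, with non-zero docking). -/
theorem jacquetVectorDocked_of_free (hJV : JacquetVectorFree) : JacquetVectorDocked := by
  intro V _ _ hS N D M C q _ X W₁ _ Q hq R hN hDMC hq3 hq3N hc hQ h1
  have hLV : V.LFunction = W₁.LFunction := LFunction_eq_of_isIsogenous_holds V W₁ hQ.1
  have hQe : ∀ ℓ : ℕ, ℓ.Prime → ¬ ℓ ∣ D * M * ∏ p ∈ C, p →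
      X.heckeFun ℓ Q.form = fun τ => ((V.LFunction ℓ : ℤ) : ℂ) * Q.form τ := by
    intro ℓ hℓ hnd
    rw [hLV]
    exact Q.hecke_eq ℓ hℓ hnd
  exact hJV V hS N D M C q X hq R hN hDMC hq3 hq3N hc h1 Q.form hQe (dockNonsplit_form_ne_zero Q hq R)

/-- **(JV₇) is WEAKER than (JV_Q)** (real proof: drop the residue-class binder). -/
theorem jacquetVectorResidual_of_docked (hJVQ : JacquetVectorDocked) : JacquetVectorResidual :=
  fun V _ _ hS N D M C q _ X W₁ _ Q hq R hN hDMC hq3 hq3N hc hQ h1 _ ↦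
    hJVQ V hS N D M C q X W₁ Q hq R hN hDMC hq3 hq3N hc hQ h1

/-- **THE GHOST CUT (real proof): (IRR)♮ ∧ (RAT)♮ ∧ (RCG) ∧ (JV₇) ⟹ (JV_Q).** At `q ≡ 3 (4)` this is (JV₇). At `q ≡ 1 (4)`: if `ℂ[G]·u_C` had no non-zero
`N`-fixed vector, then — being the irreducible `𝒱` of (IRR)♮ (it is `G`-stable, non-zero and contains `u_C ∈ 𝒱`), carrying the `T_η`-fixed vector `u_C ≠ 0`
(`indRep_dockNonsplit_of_mem_torus`) and an integer-valued character ((RAT)♮) — it would be a rational cuspidal ghost, and (RCG) would force `q ≡ 3 (4)`. -/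
theorem jacquetVectorDocked_of_ghost (hIRR : CoverIsotypicIrreducible) (hRAT : RationalCharacter) (hRCG : RationalCuspidalGhost)
    (hJV7 : JacquetVectorResidual) : JacquetVectorDocked := by
  intro V _ _ hS N D M C q _ X W₁ _ Q hq R hN hDMC hq3 hq3N hc hQ h1
  by_cases h4 : q % 4 = 3
  · exact hJV7 V hS N D M C q X W₁ Q hq R hN hDMC hq3 hq3N hc hQ h1 h4
  by_contra hno
  -- `ℂ[G]·u_C` would be CUSPIDAL: no non-zero `N`-fixed vector
  have hcusp : ∀ x ∈ R.spanG (R.dockNonsplit hq Q.form), (∀ y : ZMod q, R.indRep (upperUnip y) x = x) → x = 0 :=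
    fun x hx hfix => by_contra fun hx0 => hno ⟨x, hx, hx0, hfix⟩
  -- it is the irreducible `𝒱` of (IRR)♮
  obtain ⟨𝒱, ρ, hρ, hirr, hNS, -⟩ := hIRR V hS N D M C q X W₁ Q hq R hN hDMC hq3 hq3N hc hQ
  have hstab : ∀ g : GL (Fin 2) (ZMod q), ∀ F ∈ 𝒱, R.indRep g F ∈ 𝒱 := fun g F hF => by
    rw [← hρ g ⟨F, hF⟩]; exact (ρ g ⟨F, hF⟩).2
  have hVW : V.LFunction = W₁.LFunction := LFunction_eq_of_isIsogenous_holds V W₁ hQ.1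
  have huC : R.dockNonsplit hq Q.form ∈ 𝒱 := hNS Q.form fun ℓ hℓ hnd => by rw [hVW]; exact Q.hecke_eq ℓ hℓ hnd
  have heq : R.spanG (R.dockNonsplit hq Q.form) = 𝒱 :=
    eq_spanG_of_irreducible_of_mem R (dockNonsplit_form_ne_zero Q hq R) hstab hirr huC
  subst heq
  haveI : Module.Finite ℂ (R.spanG (R.dockNonsplit hq Q.form)) := finite_spanG R _
  have hirrW := irreducible_subtype R ρ hρ hirr
  -- with integer-valued character ((RAT)♮) and the `T_η`-fixed vector `u_C`: a rational cuspidal ghost, so `q ≡ 3 (4)` by (RCG)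
  have htr := hRAT V hS N D M C q X W₁ Q hq R hN hDMC hq3 hq3N hc hQ ρ hρ
  refine h4 (hRCG q h1 R.η R.η_irred (R.spanG (R.dockNonsplit hq Q.form)) ρ hirrW ?_ htr ?_)
  · refine ⟨⟨R.dockNonsplit hq Q.form, huC⟩, fun h => dockNonsplit_form_ne_zero Q hq R (Submodule.coe_eq_zero.mpr h),
      fun t ht => Subtype.ext ?_⟩
    rw [hρ]
    exact R.indRep_dockNonsplit_of_mem_torus hq Q.form ht
  · intro w hw
    have hw0 : (w : R.IndCuspForm) = 0 :=
      hcusp w w.2 (fun y => by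
        have h' := congrArg Subtype.val (hw y)
        rw [hρ] at h'
        exact h')
    exact Submodule.coe_eq_zero.mp hw0

/-- **(JV_Q) ∧ (NCB) ∧ (LL) ⟹ (BCV)** (real proof; §L.5 `borelCubicEigenDocking_of_jacquet` VERBATIM except that the Jacquet vector is taken from (JV_Q) at `Q.form`
— the only place §L.5 used (JV); NO (MO1), NO (PSV)). -/
theorem borelCubicEigenDocking_of_ghost (hJV : JacquetVectorDocked) (hNCB : NonCubicBorelVanishingFree)
    (hLL : NoCoverInvariantEigenform) : BorelCubicEigenDocking := by
  intro V _ _ hS N D M C q _ X W₁ _ Q hq R hN hDMC hq3 hq3N hc hQ h1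
  have hLV : V.LFunction = W₁.LFunction := LFunction_eq_of_isIsogenous_holds V W₁ hQ.1
  have hQe : ∀ ℓ : ℕ, ℓ.Prime → ¬ ℓ ∣ D * M * ∏ p ∈ C, p →
      X.heckeFun ℓ Q.form = fun τ => ((V.LFunction ℓ : ℤ) : ℂ) * Q.form τ := by
    intro ℓ hℓ hnd
    rw [hLV]
    exact Q.hecke_eq ℓ hℓ hnd
  have hgood : ∀ ℓ : ℕ, ¬ ℓ ∣ q * (D * M * ∏ p ∈ C, p) → ¬ ℓ ∣ D * M * ∏ p ∈ C, p :=
    fun ℓ h h' => h (dvd_mul_of_dvd_right h' q)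
  obtain ⟨Os, hOs, hpres⟩ := exists_splitOrder R
  obtain ⟨𝒯, hcomm, hii, hiii⟩ := coverHeckeFamilyFn_holds D M C X q hq R Os hOs hpres
  have hWC : ∀ ℓ : ℕ, ℓ.Prime → ¬ ℓ ∣ q * (D * M * ∏ p ∈ C, p) →
      ∀ w ∈ R.spanG (R.dockNonsplit hq Q.form), 𝒯 ℓ w = ((V.LFunction ℓ : ℤ) : ℂ) • coeLin R w :=
    fun ℓ hℓ hnd => eigenFn_of_mem_spanG R (𝒯 ℓ) (hcomm ℓ) (hii ℓ hℓ hnd Q.form _ (hQe ℓ hℓ (hgood ℓ hnd)))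
  have huC0 : R.dockNonsplit hq Q.form ≠ 0 := dockNonsplit_form_ne_zero Q hq R
  have huCT : ∀ t ∈ CartanTorusCubeCut.torusSubgroup R.η, R.indRep t (R.dockNonsplit hq Q.form) = R.dockNonsplit hq Q.form :=
    fun t ht => R.indRep_dockNonsplit_of_mem_torus hq Q.form ht
  -- no non-zero `G`-fixed vector in `W_C` ((LL), exactly as in (VAN)₁)
  have hnoG : ∀ x ∈ R.spanG (R.dockNonsplit hq Q.form), (∀ g : GL (Fin 2) (ZMod q), R.indRep g x = x) → x = 0 := by
    intro x hxC hfix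
    have hxT : ∀ t ∈ CartanTorusCubeCut.torusSubgroup (splitGen q), R.indRep t x = x := fun t _ => hfix t
    obtain ⟨Fc, hcd, hFcE⟩ := exists_eigenform_of_fixed hq R Os hOs 𝒯 hiii _ hWC hxC hxT
    have hinv : ∀ γ : coverUnits X q,
        coverRep X q γ (R.restrictLevel (CartanTorusCubeCut.torusSubgroup (splitGen q)) Fc) =
          R.restrictLevel (CartanTorusCubeCut.torusSubgroup (splitGen q)) Fc := by
      intro γ
      have e3 : x.1 (R.redHom γ) = x.1 1 := by
        have := congrArg (fun F : R.IndCuspForm => F.1 1) (hfix (R.redHom γ))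
        simpa only [CoverReduction.indRep_apply, one_mul] using this
      rw [hcd, R.apply_redHom, R.dockTorus_apply_one] at e3
      exact e3
    have hFc : Fc = 0 := hLL V hS N D M C q X hq R hN hDMC hq3 hq3N hc Os hOs hpres Fc hFcE hinv
    rw [hcd, hFc, dockTorus_zero]
  -- (E1) a Jacquet vector of `W_C` — from (JV_Q) — and (E2) a Borel eigenvector `w ∈ W_C` with scalars `lam`
  obtain ⟨x, hxC, hx0, hxN⟩ := hJV V hS N D M C q X W₁ Q hq R hN hDMC hq3 hq3N hc hQ h1
  obtain ⟨w, hwC, hw0, hwN, lam, hwb⟩ := exists_borelEigen_of_unipFixed R huCT hxC hx0 hxN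
  by_cases hcub : IsCubicBorelCharacter q lam
  · exact ⟨lam, w, hwC, hw0, hcub, hwb⟩
  exfalso
  by_cases hnt : ∃ t : GL (Fin 2) (ZMod q), (t : Matrix (Fin 2) (Fin 2) (ZMod q)) 0 1 = 0 ∧
      (t : Matrix (Fin 2) (Fin 2) (ZMod q)) 1 0 = 0 ∧ lam t ≠ 1
  · -- a non-cubic, non-spherical Borel type inside `W_C`: excluded by (NCB)
    exact hw0 (hNCB V hS N D M C q X hq R hN hDMC hq3 hq3N hc h1 Q.form lam w hQe hwb hcub hnt hwC)
  · -- (E3) `lam` is trivial on the diagonal torus, so `w` is `B`-FIXED: excluded by `St^{T_η} = 0` and (LL)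
    push Not at hnt
    have hwB : ∀ b : GL (Fin 2) (ZMod q), (b : Matrix (Fin 2) (Fin 2) (ZMod q)) 1 0 = 0 → R.indRep b w = w := by
      intro b hb
      obtain ⟨t, y, ht01, ht10, rfl⟩ := exists_diag_mul_unip b hb
      rw [map_mul, Module.End.mul_apply, hwN y, hwb t ht10, hnt t ht01 ht10, one_smul]
    exact false_of_borelFixed R huCT hwC hw0 hwB hnoG


/-! ### §N.4 PROVED: THE ARITHMETIC OF THE GHOST — (CTT) ⟹ (RCG). A rational `−(ζ + ζ⁻¹)` forces `ord ζ ∣ 4 ∨ ord ζ ∣ 6` (the five integers `m ∈ [−2, 2]`,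
i.e. Niven's list `{1, 2, 3, 4, 6}`), and `3 ≤ n ∣ q + 1` with `q ≡ 1 (3)` then forces `n = 4 ∣ q + 1`. -/

/-- **PROVED (Niven's step, algebraic form).** If a primitive `n`-th root of unity `ζ ∈ ℂ` (`0 < n`) has `ζ + ζ⁻¹ = m ∈ ℤ`, then `n ∣ 4` or `n ∣ 6`:
`|m| ≤ 2` by `‖ζ‖ = 1`, and each of the five quadratics `ζ² − mζ + 1 = 0` gives `ζ⁴ = 1` or `ζ⁶ = 1`. -/
theorem dvd_four_or_dvd_six_of_intTrace {n : ℕ} {ζ : ℂ} (hζ : IsPrimitiveRoot ζ n) (hn : 0 < n) {m : ℤ}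
    (hm : ζ + ζ⁻¹ = (m : ℂ)) : n ∣ 4 ∨ n ∣ 6 := by
  have hζ0 : ζ ≠ 0 := hζ.ne_zero hn.ne'
  have hnorm : ‖ζ‖ = 1 := hζ.norm'_eq_one hn.ne'
  have hm2 : |m| ≤ 2 := by
    have h1 : ‖(m : ℂ)‖ ≤ 2 := by
      rw [← hm]
      calc ‖ζ + ζ⁻¹‖ ≤ ‖ζ‖ + ‖ζ⁻¹‖ := norm_add_le _ _
        _ = 2 := by rw [norm_inv, hnorm]; norm_num
    have h2 : ‖(m : ℂ)‖ = |(m : ℝ)| := by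
      rw [← Complex.ofReal_intCast, Complex.norm_real, Real.norm_eq_abs]
    rw [h2] at h1
    have h3 : ((|m| : ℤ) : ℝ) ≤ 2 := by rw [Int.cast_abs]; exact h1
    exact_mod_cast h3
  have hquad : ζ ^ 2 + 1 = (m : ℂ) * ζ := by
    have h : (ζ + ζ⁻¹) * ζ = (m : ℂ) * ζ := by rw [hm]
    rw [add_mul, inv_mul_cancel₀ hζ0] at h
    linear_combination h
  obtain ⟨hlo, hhi⟩ := abs_le.mp hm2
  interval_cases m
  · -- `m = -2`: `ζ = -1`
    have h0 : (ζ + 1) ^ 2 = 0 := by push_cast at hquad; linear_combination hquad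
    have h1 : ζ = -1 := by have := pow_eq_zero_iff (two_ne_zero) |>.mp h0; linear_combination this
    exact Or.inl (dvd_trans (hζ.dvd_of_pow_eq_one 2 (by rw [h1]; norm_num)) (by norm_num))
  · -- `m = -1`: `ζ³ = 1`
    have h1 : ζ ^ 3 = 1 := by push_cast at hquad; linear_combination (ζ - 1) * hquad
    exact Or.inr (dvd_trans (hζ.dvd_of_pow_eq_one 3 h1) (by norm_num))
  · -- `m = 0`: `ζ⁴ = 1`
    have h1 : ζ ^ 4 = 1 := by push_cast at hquad; linear_combination (ζ ^ 2 - 1) * hquad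
    exact Or.inl (hζ.dvd_of_pow_eq_one 4 h1)
  · -- `m = 1`: `ζ⁶ = 1`
    have h1 : ζ ^ 6 = 1 := by push_cast at hquad; linear_combination (ζ ^ 4 + ζ ^ 3 - ζ - 1) * hquad
    exact Or.inr (hζ.dvd_of_pow_eq_one 6 h1)
  · -- `m = 2`: `ζ = 1`
    have h0 : (ζ - 1) ^ 2 = 0 := by push_cast at hquad; linear_combination hquad
    have h1 : ζ = 1 := by have := pow_eq_zero_iff (two_ne_zero) |>.mp h0; linear_combination this
    exact Or.inl (dvd_trans (hζ.dvd_of_pow_eq_one 1 (by rw [h1]; norm_num)) (by norm_num))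

/-- **PROVED (the residue-class step).** `q ≡ 1 (3)`, `3 ≤ n ∣ q + 1` and `n ∣ 4 ∨ n ∣ 6` force `n = 4`, hence `q ≡ 3 (mod 4)`. -/
theorem mod_four_eq_three_of_ghostOrder {q n : ℕ} (h1 : q % 3 = 1) (hn3 : 3 ≤ n) (hnq : n ∣ q + 1) (h46 : n ∣ 4 ∨ n ∣ 6) :
    q % 4 = 3 := by
  rcases h46 with h4 | h6
  · have hn4 : n ≤ 4 := Nat.le_of_dvd (by norm_num) h4
    interval_cases n <;> omega
  · have hn6 : n ≤ 6 := Nat.le_of_dvd (by norm_num) h6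
    interval_cases n <;> omega

/-- **PROVED: (CTT) ⟹ (RCG).** An integer trace `−(ζ + ζ⁻¹) ∈ ℤ` at the elliptic element of (CTT) makes `ord ζ ∣ 4 ∨ ord ζ ∣ 6`; with `3 ≤ ord ζ ∣ q + 1` and
`q ≡ 1 (3)` this is `4 ∣ q + 1`. So the ONLY finite-group input of the ghost cut is the cuspidal row of the character table. -/
theorem rationalCuspidalGhost_of_type (hCTT : CuspidalTorusType) : RationalCuspidalGhost := by
  intro q _ h1 eta hη W _ _ _ ρ hirr hfix htr hcusp
  obtain ⟨t, -, n, ζ, hn3, hnq, hζ, htrace⟩ := hCTT q eta hη W ρ hirr hfix hcusp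
  obtain ⟨m, hm⟩ := htr t
  have hsum : ζ + ζ⁻¹ = ((-m : ℤ) : ℂ) := by
    rw [Int.cast_neg, ← hm, htrace, neg_neg]
  exact mod_four_eq_three_of_ghostOrder h1 hn3 hnq (dvd_four_or_dvd_six_of_intTrace hζ (by omega) hsum)

end Ghost

/-! ## §4 The SEVEN stubs (the ONLY sorries of this file): (MO1) [classical, HARDEST in tree], (RAT)♮ [generation 15, integrality], (CTT) [NEW, finite group
theory; (RCG) derived, §N.4], (JV₇) [NEW residual, `q ≡ 7 (12)`], (NCB) [generation 25, `q ≡ 1 (3)`], (CV♭) [generation 23, `q ≡ 2 (3)`], (DS) ∧ (JLᶜ) [inputs of record].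
Generation 25's (JV) `stub_jacquetVector` is NO LONGER a stub. -/

/-- (MO1) — generation 21's classical leaf (the tree's `CartanDoubleCoset.SplitLevelMultiplicityOne`), rev 9 VERBATIM. CLASSICAL; HARDEST in tree;
UNDECIDED-in-tree ∕ WEAKER than (ISO)♮; consumed at (L1S) (hence (IRR)♮, U1) and (VAN)₂ (U3). -/
theorem stub_splitLevelMultiplicityOne : SplitLevelMultiplicityOne := by
  sorry

/-- (RAT)♮ — generation 15's integrality leaf (§N.1), VERBATIM; WEAKER than (ISO)♮ (PROVED `rationalCharacter_of_iso`); ATTACKABLE in tree (cmrank real-form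
descent of the period lattice); consumed ONLY at the ghost cut (§N.3), regime `q ≡ 1 (12)`. -/
theorem stub_rationalCharacter : RationalCharacter := by
  sorry

/-- (CTT) — NEW (§N.2): the cuspidal torus type (cuspidal row of the character table of `GL₂(𝔽_q)`, every prime `q`); FINITE GROUP THEORY, `V`-free;
ATTACKABLE in tree (the §F.6 pinning engine `cubicCuspidalCharacter_of_five_le`, made `ν`-general); gives (RCG) by the PROVED arithmetic of §N.4. -/
theorem stub_cuspidalTorusType : CuspidalTorusType := by
  sorry

/-- (JV₇) — NEW residual leaf (§N.2): the docked Jacquet vector on `q ≡ 1 (3) ∧ q ≡ 3 (4)` only; WEAKER than (JV_Q) ∕ (JV) ∕ (BCV); UNDECIDED-in-tree;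
INSTRUMENTABLE (Atkin–Li cubic twist of level `N∕q`); IDEA-NEEDED in tree (print: the `V`-part is not the `e = 4` ghost `π(ν₄)`). -/
theorem stub_jacquetVectorResidual : JacquetVectorResidual := by
  sorry

/-- (NCB) — generation 25's leaf (§L.4), rev 9 VERBATIM, `q ≡ 1 (3)`; UNDECIDED-in-tree; WEAKER-in-print than (ISO)♮; INSTRUMENTABLE (kit j342924 PASS-ALL 56∕56);
RE-SOURCED by this node: a non-cubic Borel eigenvector certifies by itself that `π_{V,q}` is not supercuspidal, so the print input is PRINCIPAL-SERIES
local–global compatibility (Deligne 1973 ∕ Langlands 1973), not Carayol (A). -/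
theorem stub_nonCubicBorelVanishing : NonCubicBorelVanishingFree := by
  sorry

/-- (CV♭) — generation 23's leaf (§J.4), rev 9 VERBATIM, `q ≡ 2 (3)`; WEAKER-in-print than (VAN)₂; BARRIER(print) = Deligne–Carayol; INSTRUMENTABLE. -/
theorem stub_nonsplitCubicVanishingFree : NonsplitCubicVanishingFree := by
  sorry

/-- (DS) ∧ (JLᶜ) — the Galois ∕ transfer inputs OF RECORD (cite-pure; rev 9 VERBATIM), the inputs of §K (hence of (LL), (VAN)₁ and (E3)).
[cite: DeligneSerre1974, Thm. 6.1] [cite: JacquetLanglands1970, Thm. 16.1] -/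
theorem stub_galoisTransferInputs :
    DeligneSerre1974.thm61_exists_adicGaloisRep ∧ Literature.NumberTheory.Automorphic.jacquetLanglands_cartanCover_newform := by
  sorry

/-! ## §5 Composition — the crux decls BY NAME and NUM♮ (real proofs, no sorry): (L1S) = `splitFixedRankOne_of_multiplicityOne` (MO1), (IRR)♮ =
`coverIsotypicIrreducible_of'` (L1S), (LL) from §K.4, (JV_Q) from §N.3, (BCV) from §N.3, (VAN) from §J.5, (FGT) = `cubicCharacterTables`, (ISO)♮ by the TREE's
`coverIsotypicComponent_of_lines'`, assembled by the TREE's `CartanNaturalChain` closers. -/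

/-- **(BCV) `BorelCubicEigenDocking` from (MO1), (RAT)♮, (RCG), (JV₇), (NCB) and the inputs of record (DS) ∧ (JLᶜ)** (real proof). -/
theorem borelCubicEigenDocking_of_ghostInputs (hMO : SplitLevelMultiplicityOne) (hRAT : RationalCharacter) (hRCG : RationalCuspidalGhost)
    (hJV7 : JacquetVectorResidual) (hNCB : NonCubicBorelVanishingFree)
    (hGT : DeligneSerre1974.thm61_exists_adicGaloisRep ∧ Literature.NumberTheory.Automorphic.jacquetLanglands_cartanCover_newform) :
    BorelCubicEigenDocking :=
  borelCubicEigenDocking_of_ghost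
    (jacquetVectorDocked_of_ghost (coverIsotypicIrreducible_of' (splitFixedRankOne_of_multiplicityOne hMO)) hRAT hRCG hJV7)
    hNCB (noCoverInvariantEigenform_of_facts hGT.1 hGT.2)

/-- **(VAN) `NonsplitTorusCubicVanishing` from (CV♭), (MO1) and (DS) ∧ (JLᶜ)** — generation 23's cut with (LL) discharged by §K.4 (rev 9 verbatim). -/
theorem nonsplitTorusCubicVanishing_of_ghostInputs (hCV : NonsplitCubicVanishingFree) (hMO : SplitLevelMultiplicityOne)
    (hGT : DeligneSerre1974.thm61_exists_adicGaloisRep ∧ Literature.NumberTheory.Automorphic.jacquetLanglands_cartanCover_newform) :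
    NonsplitTorusCubicVanishing :=
  nonsplitTorusCubicVanishing_of_typecut (noCoverInvariantEigenform_of_facts hGT.1 hGT.2) hCV hMO

/-- (ISO)♮ `CartanNatural.CoverIsotypicComponent` from the SEVEN statements of this node: (MO1), (RAT)♮, (RCG), (JV₇), (NCB), (CV♭), (DS) ∧ (JLᶜ). -/
theorem coverIsotypicComponent_of_ghost (hMO : SplitLevelMultiplicityOne) (hRAT : RationalCharacter) (hRCG : RationalCuspidalGhost)
    (hJV7 : JacquetVectorResidual) (hNCB : NonCubicBorelVanishingFree) (hCV : NonsplitCubicVanishingFree)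
    (hGT : DeligneSerre1974.thm61_exists_adicGaloisRep ∧ Literature.NumberTheory.Automorphic.jacquetLanglands_cartanCover_newform) :
    CartanNatural.CoverIsotypicComponent :=
  coverIsotypicComponent_of_lines' (splitFixedRankOne_of_multiplicityOne hMO) (borelCubicEigenDocking_of_ghostInputs hMO hRAT hRCG hJV7 hNCB hGT)
    (nonsplitTorusCubicVanishing_of_ghostInputs hCV hMO hGT) cubicCharacterTables

/-- **THIS NODE'S COMPOSITION — THE CRUX DECL BY NAME on `ClassRecordThree` from SEVEN statements**: (MO1), (RAT)♮, (RCG), (JV₇), (NCB), (CV♭), ((DS) ∧ (JLᶜ)). -/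
theorem CartanOnePlaceDegreeLawAtThree_of_ghost :
    SplitLevelMultiplicityOne → RationalCharacter → RationalCuspidalGhost → JacquetVectorResidual → NonCubicBorelVanishingFree →
      NonsplitCubicVanishingFree →
      (DeligneSerre1974.thm61_exists_adicGaloisRep ∧ Literature.NumberTheory.Automorphic.jacquetLanglands_cartanCover_newform) →
      Summit.BirchSwinnertonDyer.BirchSwinnertonDyer.Theses.ClassRecordThree.CartanOnePlaceDegreeLawAtThree :=
  fun hMO hRAT hRCG hJV7 hNCB hCV hGT ↦
    classRecordThree_cartanOnePlaceDegreeLawAtThree_of_printInputsThreeNatural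
      ⟨coverIsotypicComponent_of_ghost hMO hRAT hRCG hJV7 hNCB hCV hGT, hGT⟩

/-- **THE CRUX DECL BY NAME on `KolyvaginRoadThree`** (twin) from the same seven statements. -/
theorem CartanOnePlaceDegreeLawAtThree_of_ghost' :
    SplitLevelMultiplicityOne → RationalCharacter → RationalCuspidalGhost → JacquetVectorResidual → NonCubicBorelVanishingFree →
      NonsplitCubicVanishingFree →
      (DeligneSerre1974.thm61_exists_adicGaloisRep ∧ Literature.NumberTheory.Automorphic.jacquetLanglands_cartanCover_newform) →
      Summit.BirchSwinnertonDyer.BirchSwinnertonDyer.Theses.KolyvaginRoadThree.CartanOnePlaceDegreeLawAtThree :=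
  fun hMO hRAT hRCG hJV7 hNCB hCV hGT ↦
    kolyvaginRoadThree_cartanOnePlaceDegreeLawAtThree_of_printInputsThreeNatural
      ⟨coverIsotypicComponent_of_ghost hMO hRAT hRCG hJV7 hNCB hCV hGT, hGT⟩

/-- **THE CRUX DECL BY NAME from the seven STUB STATEMENTS exactly** ((CTT) in place of (RCG), via §N.4). -/
theorem CartanOnePlaceDegreeLawAtThree_of_ghostType :
    SplitLevelMultiplicityOne → RationalCharacter → CuspidalTorusType → JacquetVectorResidual → NonCubicBorelVanishingFree →
      NonsplitCubicVanishingFree →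
      (DeligneSerre1974.thm61_exists_adicGaloisRep ∧ Literature.NumberTheory.Automorphic.jacquetLanglands_cartanCover_newform) →
      Summit.BirchSwinnertonDyer.BirchSwinnertonDyer.Theses.ClassRecordThree.CartanOnePlaceDegreeLawAtThree :=
  fun hMO hRAT hCTT hJV7 hNCB hCV hGT ↦
    CartanOnePlaceDegreeLawAtThree_of_ghost hMO hRAT (rationalCuspidalGhost_of_type hCTT) hJV7 hNCB hCV hGT

/-- **The NUM♮ ITEM decl (32276) on `ClassRecordThree`** from the seven statements. -/
theorem CartanOnePlaceDegreeLawAtThreeNatural_of_ghost :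
    SplitLevelMultiplicityOne → RationalCharacter → RationalCuspidalGhost → JacquetVectorResidual → NonCubicBorelVanishingFree →
      NonsplitCubicVanishingFree →
      (DeligneSerre1974.thm61_exists_adicGaloisRep ∧ Literature.NumberTheory.Automorphic.jacquetLanglands_cartanCover_newform) →
      Summit.BirchSwinnertonDyer.BirchSwinnertonDyer.Theses.ClassRecordThree.CartanOnePlaceDegreeLawAtThreeNatural :=
  fun hMO hRAT hRCG hJV7 hNCB hCV hGT ↦
    cartanOnePlaceDegreeLawAtThreeNatural_of_printInputsThree ⟨coverIsotypicComponent_of_ghost hMO hRAT hRCG hJV7 hNCB hCV hGT, hGT⟩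

/-- **Generation 25–26's five-statement composition is RECOVERED** (real proof): (JV) ⟹ (JV_Q) ⟹ (JV₇), and (RAT)♮ ∕ (RCG) are then not needed. -/
theorem CartanOnePlaceDegreeLawAtThree_of_jacquetFrame :
    SplitLevelMultiplicityOne → JacquetVectorFree → NonCubicBorelVanishingFree → NonsplitCubicVanishingFree →
      (DeligneSerre1974.thm61_exists_adicGaloisRep ∧ Literature.NumberTheory.Automorphic.jacquetLanglands_cartanCover_newform) →
      Summit.BirchSwinnertonDyer.BirchSwinnertonDyer.Theses.ClassRecordThree.CartanOnePlaceDegreeLawAtThree :=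
  fun hMO hJV hNCB hCV hGT ↦
    classRecordThree_cartanOnePlaceDegreeLawAtThree_of_printInputsThreeNatural
      ⟨coverIsotypicComponent_of_lines' (splitFixedRankOne_of_multiplicityOne hMO)
          (borelCubicEigenDocking_of_ghost (jacquetVectorDocked_of_free hJV) hNCB (noCoverInvariantEigenform_of_facts hGT.1 hGT.2))
          (nonsplitTorusCubicVanishing_of_ghostInputs hCV hMO hGT) cubicCharacterTables, hGT⟩

/-- The crux decl from the seven STUBS (closes modulo exactly the seven sorries of §4; for the audit). -/
theorem CartanOnePlaceDegreeLawAtThree_of_stubs :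
    Summit.BirchSwinnertonDyer.BirchSwinnertonDyer.Theses.ClassRecordThree.CartanOnePlaceDegreeLawAtThree :=
  CartanOnePlaceDegreeLawAtThree_of_ghost stub_splitLevelMultiplicityOne stub_rationalCharacter (rationalCuspidalGhost_of_type stub_cuspidalTorusType)
    stub_jacquetVectorResidual stub_nonCubicBorelVanishing stub_nonsplitCubicVanishingFree stub_galoisTransferInputs

/-- The `KolyvaginRoadThree` twin from the seven STUBS. -/
theorem CartanOnePlaceDegreeLawAtThree_of_stubs' :
    Summit.BirchSwinnertonDyer.BirchSwinnertonDyer.Theses.KolyvaginRoadThree.CartanOnePlaceDegreeLawAtThree :=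
  CartanOnePlaceDegreeLawAtThree_of_ghost' stub_splitLevelMultiplicityOne stub_rationalCharacter (rationalCuspidalGhost_of_type stub_cuspidalTorusType)
    stub_jacquetVectorResidual stub_nonCubicBorelVanishing stub_nonsplitCubicVanishingFree stub_galoisTransferInputs

end Summit.BirchSwinnertonDyer.BirchSwinnertonDyer.Cruxes.CartanOnePlaceDegreeLawAtThree.Ghost
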